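import Literature.AlgebraicGeometry.Resolution.InseparableLocalUniformizationEngine
import Literature.AlgebraicGeometry.Resolution.InseparableLocalUniformizationLemmasProofs
import Literature.AlgebraicGeometry.Resolution.SmoothEquivalenceNormalizationProofs
import Literature.AlgebraicGeometry.Resolution.ValuationRingOpenInNormalizationProofs
import Literature.AlgebraicGeometry.Resolution.InseparableLocalUniformizationDefectStep
import Literature.AlgebraicGeometry.Resolution.InseparableLocalUniformizationHeightInduction
import Literature.AlgebraicGeometry.Resolution.InseparableLocalUniformizationWeakConclusion
import Literature.AlgebraicGeometry.Resolution.InseparableLocalUniformizationStepFour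
import Literature.AlgebraicGeometry.Resolution.SmoothDescentField
import Mathlib.FieldTheory.IsAlgClosed.AlgebraicClosure
import HarnessLib

/-!
# Inseparable local uniformization: Steps 3–4 of the proof of Thm. 4.1.1, proved up to the final enlargement of `l`

Topic: `Literature/AlgebraicGeometry/Resolution`. M. Temkin, *Inseparable local uniformization*,
J. Algebra 373 (2013) 65–119 = arXiv:0804.1554v3 (numbering and pages of this version; in the
41-pp. arXiv version held in the literature store the proof of Thm. 4.1.1 is on pp. 29–30, and
Lemmas 2.8.4/2.8.5 are 2.7.4/2.7.5). The named fact `Temkin2013_Steps34`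
(`InseparableLocalUniformizationEngine.lean`; corrected rendering `Temkin2013_Steps34_tower`,
`InseparableLocalUniformizationEngineTower.lean`, in which `k̄` acts on `K₁` through `K`) packages
Steps 3–4 of the proof of Thm. 4.1.1 (pp. 48–49):

  "Step 3. Refine `Y` and replace the other entries of diagram (3) with the `η`-normalized base
  changes so that `xᵢ` and `yᵢ` become smooth-equivalent. … by Lemma 2.8.4 there exists `α` such
  that the points `x_{i,α}` and `y_{i,α}` are smooth-equivalent over `Y_α` … Step 4. Smoothen the
  points `yᵢ` by an additional refining of `Y` and a purely inseparable extension of `k̄`. … the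
  induction assumption applies to the scheme `Y` and the valued `k̄`-fields `mᵢ` … we extend `k̄`
  as follows: replace `k̄`, `mᵢ`, `K`, `Kᵢ` with `l̄`, `l̄mᵢ`, `l̄K`, `l̄Kᵢ`, respectively; replace
  `Y`, `Yᵢ`, `X`, `Xᵢ` with their normalizations in these fields … Then (the new) `yᵢ` is
  `l`-smooth by the construction and `xᵢ` is still smooth-equivalent to `yᵢ` by Lemma 2.8.5 …
  Thus, we achieve that the center of each `Kᵢ` on `Xᵢ` is `l`-smooth" [v3 adds: "and, replacing
  `l` with a purely inseparable extension, we can also arrange that `x₁` is a simple `l`-smooth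
  point"].

This file PROVES all of this EXCEPT the bracketed last sentence, for `n = 1` and in the affine
vocabulary of the companion files, from inputs that are all theorems of the tree:
Lemma 2.8.4 (`Temkin2013_Lemma284_holds`), the openness of `S₁` in `Nr_m(S)`
(`Temkin2013_valuationRingOpen_holds`), Lemma 2.8.5 in its corrected rendering
(`Temkin2013_Lemma285_normal_holds`), descent of `l`-smoothness along smooth covers over a field
(`AreSmoothEquivalent.isSmoothAt_left_of_field'`, `SmoothDescentField.lean` — so that the named
fact `Stacks05B5` is NOT needed), and E. Noether's finiteness of integral closure:

* `descentConclusionWeak_of_steps34Data` — PROVED: for the data of `Temkin2013_Steps34_tower`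
  (verbatim its binders) the WEAK descent conclusion `Temkin2013DescentConclusionWeak`
  (`InseparableLocalUniformizationWeakConclusion.lean`: the conclusion of Thm. 4.1.1 with the
  centre `l`-smooth, "simple" and "regular" dropped) holds. What separates this from
  `Temkin2013_Steps34_tower` itself is exactly the final enlargement of `l` (weak ⇒ full).
* `exists_level_areSmoothEquivalent` — Step 3, PROVED: the directed family of all affine
  refinements `Y_α = Spec B_α` of `Y` inside `k̄°` (union `k̄°`), `X̄₀ = Spec Nr_{K₁}(A)`,
  `Ȳ₀ = Spec Nr_m(B)`; `S₁ = Spec m°` is a principal open of `Nr_m(S)`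
  (`exists_isLocalizationAway_etaModel`, hence smooth, `exists_smooth_etaModel`), so the given
  smooth-equivalence of `z₁` with `s₁` over `S` is one with the image of `s₁` in `Nr_m(S)`
  (`AreSmoothEquivalent.of_smooth_right`), and Lemma 2.8.4 yields a level `B₁` such that at
  every finer level `B′` the centres `x_{1,B′} ∈ X_{1,B′} = Nr_{K₁}(Nr_{K₁}(A)·B′)` and
  `y_{1,B′} ∈ Y_{1,B′} = Nr_m(Nr_m(B)·B′)` are smooth-equivalent over `B′`.
* `descentConclusionWeak_of_level` — Step 4, PROVED: given such a level `B′` at which Thm. 4.1.1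
  for `Y` (the hypothesis `Temkin2013DescentFor k k̄ k̄°`, applied in the assembly to the normal
  model `Nr_{k̄}(Y₁)` and `(m, m°)`) has produced `m′ = L^Y m ⊇ L^Y ⊇ l`, `m′°` and the
  `l`-smooth centre `y′` of `m′°` on `Nr_{m′}(B′)`: the compositum `L₁ = L^Y K₁`
  (`exists_purelyInseparable_compositum`), the valuation ring `L₁°` (Chevalley,
  `exists_valuationSubring_comap_eq`), Lemma 2.8.5 for the normal models `X_{1,B′}`, `Y_{1,B′}`
  over `B′` and the purely inseparable `L^Y/k̄` (the preimages `x′ ∈ Nr_{L₁}(X_{1,B′})`,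
  `y′ ∈ Nr_{m′}(Y_{1,B′})` of the centres are smooth-equivalent over `B′`), compatibility of the
  two `l`-structures of a common smooth cover (they agree on `k`, `l/k` is purely inseparable and
  smooth covers of domains are reduced, `ringHom_eq_of_comp_eq_of_forall_pow_mem`), descent of
  `l`-smoothness (`isSmoothAt_left_of_field'`), and the packaging with `X′ = Spec k[A ∪ B′]`,
  `N = Nr_{L₁}(X′) = Nr_{L₁}(X_{1,B′})`, `l₁ = ` the copy of `l` inside `L₁`, `L = K(L^Y)`
  (`descentConclusionWeak_of_data`).
* Bricks, PROVED: `isSmoothAt_comap_algEquiv`, `isSmoothAt_iff_of_ringEquiv` (smoothness at a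
  prime is invariant under isomorphism of pairs ground ring/algebra),
  `formallySmooth_iff_of_bijective_algebraMap`, `isSmoothAt_of_eq`, `isIntegral_subring_map_iff`,
  `isIntegral_nrIn_iff`.

## Relation to `InseparableLocalUniformizationStepThree.lean` / `…StepFour.lean`

Both files landed (by other hands) while this one was being written; the three were developed
independently and this file now imports `…StepFour.lean` for the shared valuation brick
`mk_algebraMap_mem_maximalIdeal_iff`.
* Step 3: `step3_exists_level` there and `exists_level_areSmoothEquivalent` here prove the same
  printed step by the same route (hypotheses agree up to `hdim : < ⊤` there vs `≤ 1` here, the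
  conclusion up to writing the `Y`-model `nrIn (B′.map …)` there vs
  `etaModel k̄ (Nr_m B) B′` here — equal carriers). The proof here is kept rather than derived
  from `step3_exists_level` because Step 4 below consumes exactly the `etaModel`/`etaModelBaseMap`
  shape in which Lemma 2.8.4 (`Temkin2013_Lemma284_holds`) delivers its conclusion; deriving one
  from the other means transporting both structure maps and both points along the carrier
  equalities (cf. `areSmoothEquivalent_congr₂` there), which is no shorter than the proof.
* Step 4: `step4_core`/`step4_weakConclusion` there are CONDITIONAL on the named fact
  `Stacks05B5` and take the level `B′` and the output of Thm. 4.1.1 for `Y` as hypotheses;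
  `descentConclusionWeak_of_level` here is the same step made UNCONDITIONAL by
  `AreSmoothEquivalent.isSmoothAt_left_of_field'` (`SmoothDescentField.lean`), and
  `descentConclusionWeak_of_steps34Data` adds the assembly from the verbatim binders of
  `Temkin2013_Steps34_tower` (Step 3, normalisation of the level `Y₁`, the hypothesis
  `Temkin2013DescentFor k k̄ k̄°`). So `step4_weakConclusion (h05 : Stacks05B5)` is superseded
  (it can be retired, or re-derived from `descentConclusionWeak_of_level`).
* Bricks: `exists_purelyInseparable_compositum` here overlaps `exists_compositum` there
  (here: an abstract field with a ring map from `k′`, there: an intermediate field of a given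
  `Ω ⊇ K₁`); `isIntegral_nrIn_iff` here is strictly more general than `isIntegral_nrIn_map_iff`
  there (any subring `T ⊆ K₁`, not only `Nr_{K₁}` of the image of a `k`-subalgebra of `K`) —
  dedupe in that direction; `isSmoothAt_iff_of_ringEquiv` here (isomorphism of PAIRS
  ground ring/algebra) contains `isSmoothAt_of_ringEquiv_base` there (ground ring only) as the
  case `eA = RingEquiv.refl`.

## Sources

* M. Temkin, *Inseparable local uniformization*, arXiv:0804.1554v3: proof of Thm. 4.1.1,
  Steps 3–4 and Remarks 4.1.2/4.1.3 (pp. 48–49); Lemmas 2.8.4, 2.8.5 (p. 31); Prop. 2.3.8 (p. 14).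

## Rendering notes

* As in `Temkin2013_Steps34_tower`: `k̄` (`kb`) acts on `K₁` through `K` (no separate binder);
  `Nr ↦ nrIn`, `Nr_{K₁}(X ×_Y Y′) ↦ etaModel kb C B′` with `C = Nr_{K₁}(A)` entering Step 4 as a
  variable with its defining equation (small proof terms); points are contractions of maximal
  ideals of valuation rings along `Subring.inclusion`s; `X′`, `Y′` of Lemma 2.8.5 are Mathlib's
  `integralClosure (X_{1,B′}) L₁`, `integralClosure (Y_{1,B′}) m′`, identified with the
  `k`-subalgebras `Nr_{L₁}(k[A ∪ B′])` and the given `Nr_{m′}(B′)` by equality of carriers.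
* Instance search over the many subtypes of this proof is slow; two lemmas
  (`descentConclusionWeak_of_data`, `isSmoothAt_iff_of_ringEquiv`) exist only to move the final
  transport into a small context, and `l₁`, `e₁ : l ≃ l₁` are introduced opaquely.
-/

noncomputable section

open IsLocalRing

namespace Literature.AlgebraicGeometry.Resolution

universe u

/-! ### Step 3a: `S₁ = Spec m°` is open in `Nr_m(S)` -/

section openImmersion

variable {kb m : Type u} [Field kb] [Field m] [Algebra kb m]

/-- **`Spec m°` is a principal open of `Spec Nr_m(C′·k̄°)`** (Temkin 2013, proof of Thm. 4.1.1,
Step 3, p. 49: "Recall that `Sᵢ` is open in `Nr_{mᵢ}(S)`"): if `m/k̄` is finite, `k̄°` has finite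
height, `m° ∩ k̄ = k̄°` and `C′ ⊆ m°`, then the `η`-model `Y_S = Nr_m(C′·k̄°)` lies in `m°` and
`m°` is the localization of `Y_S` away from one element (`Temkin2013_valuationRingOpen_holds`).
[cite: Temkin2013, proof of Thm. 4.1.1 Step 3 (arXiv:0804.1554v3 p. 49)] -/
theorem exists_isLocalizationAway_etaModel [FiniteDimensional kb m] (Ob : ValuationSubring kb)
    (hdim : ringKrullDim Ob < ⊤) (Om : ValuationSubring m)
    (hOm : Om.comap (algebraMap kb m) = Ob) (C' : Subring m) (hC' : C' ≤ Om.toSubring) :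
    ∃ (hYS : etaModel kb C' Ob.toSubring ≤ Om.toSubring) (f : etaModel kb C' Ob.toSubring),
      @IsLocalization.Away _ _ f Om _ (Subring.inclusion hYS).toAlgebra := by
  classical
  have hObOm : Ob.toSubring.map (algebraMap kb m) ≤ Om.toSubring := by
    rintro _ ⟨c, hc, rfl⟩
    have : c ∈ Om.comap (algebraMap kb m) := by rw [hOm]; exact hc
    exact this
  have hYS : etaModel kb C' Ob.toSubring ≤ Om.toSubring :=
    nrIn_le_valuationSubring Om (sup_le hC' hObOm)
  obtain ⟨f, hfi, hfO, hfiO, hchar⟩ :=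
    Temkin2013_valuationRingOpen_holds kb m inferInstance Ob hdim Om hOm
  -- elements integral over `k̄°` lie in `Y_S`
  have hint : ∀ a : m, IsIntegral (Ob.toSubring.map (algebraMap kb m)) a →
      a ∈ etaModel kb C' Ob.toSubring := fun a ha => by
    have h1 : a ∈ nrIn (Ob.toSubring.map (algebraMap kb m)) := mem_nrIn_iff.mpr ha
    exact nrIn_mono (le_sup_right (a := C')) h1
  have hfYS : f ∈ etaModel kb C' Ob.toSubring := hint f hfi
  letI := (Subring.inclusion hYS).toAlgebra
  by_cases hf0 : f = 0
  · -- degenerate witness: then `m°` consists of the elements integral over `k̄°`, i.e. `m° = Y_S`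
    have hOmYS : ∀ z : Om, (z : m) ∈ etaModel kb C' Ob.toSubring := fun z => by
      obtain ⟨a, ha, n, hz⟩ := (hchar z).mp z.2
      cases n with
      | zero => rw [hz, pow_zero, div_one]; exact hint a ha
      | succ n => rw [hz, hf0, zero_pow (Nat.succ_ne_zero n), div_zero]; exact Subring.zero_mem _
    refine ⟨hYS, 1, ?_⟩
    refine { map_units := ?_, surj := ?_, exists_of_eq := ?_ }
    · intro y
      obtain ⟨n, hn⟩ := y.2
      have hy : (y : etaModel kb C' Ob.toSubring) = 1 := by rw [← hn]; exact one_pow n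
      rw [hy, map_one]
      exact isUnit_one
    · intro z
      refine ⟨(⟨z, hOmYS z⟩, 1), ?_⟩
      rw [OneMemClass.coe_one, map_one, mul_one]
      rfl
    · intro x y hxy
      refine ⟨1, ?_⟩
      have : (x : m) = y := congrArg (fun w : Om => (w : m)) hxy
      rw [Subtype.ext this]
  refine ⟨hYS, ⟨f, hfYS⟩, ?_⟩
  refine { map_units := ?_, surj := ?_, exists_of_eq := ?_ }
  · intro y
    obtain ⟨n, hn⟩ := y.2
    have hfu : IsUnit (⟨f, hfO⟩ : Om) := isUnit_of_inv_mem Om hfO hfiO hf0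
    have hy : algebraMap (etaModel kb C' Ob.toSubring) Om y = (⟨f, hfO⟩ : Om) ^ n := by
      rw [show (y : etaModel kb C' Ob.toSubring) = ⟨f, hfYS⟩ ^ n from hn.symm, map_pow]; rfl
    rw [hy]
    exact hfu.pow n
  · intro z
    obtain ⟨a, ha, n, hz⟩ := (hchar z).mp z.2
    refine ⟨(⟨a, hint a ha⟩, ⟨⟨f, hfYS⟩ ^ n, n, rfl⟩), ?_⟩
    apply Subtype.ext
    change (z : m) * f ^ n = a
    rw [hz, div_mul_cancel₀ a (pow_ne_zero n hf0)]
  · intro x y hxy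
    refine ⟨1, ?_⟩
    have : (x : m) = y := congrArg (fun w : Om => (w : m)) hxy
    rw [Subtype.ext this]

/-- `m°` is a smooth algebra over the `η`-model `Y_S = Nr_m(C′·k̄°)` (an open immersion is smooth).
[folklore] -/
theorem exists_smooth_etaModel [FiniteDimensional kb m] (Ob : ValuationSubring kb)
    (hdim : ringKrullDim Ob < ⊤) (Om : ValuationSubring m)
    (hOm : Om.comap (algebraMap kb m) = Ob) (C' : Subring m) (hC' : C' ≤ Om.toSubring) :
    ∃ (hYS : etaModel kb C' Ob.toSubring ≤ Om.toSubring),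
      @Algebra.Smooth (etaModel kb C' Ob.toSubring) _ Om _ (Subring.inclusion hYS).toAlgebra := by
  obtain ⟨hYS, f, hf⟩ := exists_isLocalizationAway_etaModel Ob hdim Om hOm C' hC'
  letI := (Subring.inclusion hYS).toAlgebra
  exact ⟨hYS, Algebra.Smooth.of_isLocalization_Away f⟩

end openImmersion

/-! ### Step 3: descending the smooth-equivalence to an affine refinement of `Y` (Lemma 2.8.4) -/

section stepThree

variable {k K : Type u} [Field k] [Field K] [Algebra k K]

/-- `1 < ⊤` in `WithBot ℕ∞` (heights of valuation rings of height `≤ 1` are finite). [folklore] -/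
theorem ringKrullDim_lt_top_of_le_one {R : Type*} [CommRing R] (h : ringKrullDim R ≤ 1) :
    ringKrullDim R < ⊤ :=
  lt_of_le_of_lt h (by decide)

/-- **Step 3 of the proof of Thm. 4.1.1** (Temkin 2013, p. 49: "Let `{Y_α}` be the projective
family of all affine refinements of `Y` … `S →~ proj lim Y_α` … by Lemma 2.8.4 there exists `α`
such that the points `x_{i,α}` and `y_{i,α}` are smooth-equivalent over `Y_α`"), PROVED for `n = 1`
in the affine vocabulary: if the centre `z₁` of `K₁°` on `X_{1,S} = Nr_{K₁}(Nr_{K₁}(A)·k̄°)` is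
smooth-equivalent over `S = Spec k̄°` to the closed point of `S₁ = Spec m°`, then there is an affine
refinement `Y₁ = Spec B₁` of `Y = Spec B` (`B ≤ B₁ ⊆ k̄°` finitely generated) such that for EVERY
further affine refinement `Y′ = Spec B′`, `B₁ ≤ B′ ⊆ k̄°`, the centre `x_{1,B′}` of `K₁°` on
`X_{1,B′} = Nr_{K₁}(Nr_{K₁}(A)·B′)` and the centre `y_{1,B′}` of `m°` on `Y_{1,B′} = Nr_m(Nr_m(B)·B′)`
are smooth-equivalent over `B′`. Ingredients: `S₁` is open in `Nr_m(S)`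
(`exists_smooth_etaModel`, from `Temkin2013_valuationRingOpen_holds`), so `z₁` is smooth-equivalent
over `k̄°` to the image of `s₁` in `Nr_m(S) = Nr_m(Nr_m(B)·k̄°)` (`AreSmoothEquivalent.of_smooth_right`);
then Lemma 2.8.4 (`Temkin2013_Lemma284_holds`) for the directed family of all finitely generated
`B ≤ B_α ⊆ k̄°`, whose union is `k̄°`, with `X̄₀ = Spec Nr_{K₁}(A)` (generic fibre `k̄[Nr_{K₁}(A)]`, a
localization of a normal ring, is integrally closed in `K₁`) and `Ȳ₀ = Spec Nr_m(B)`.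
[cite: Temkin2013, proof of Thm. 4.1.1 Step 3 (arXiv:0804.1554v3 p. 49)] -/
theorem exists_level_areSmoothEquivalent
    (O : ValuationSubring K)
    (kb : IntermediateField k K) (hdim : ringKrullDim (O.comap (algebraMap kb K)) ≤ 1)
    (B : Subalgebra k kb) (hBO : B.toSubring ≤ (O.comap (algebraMap kb K)).toSubring)
    (hBfg : B.FG) (hBfr : IsFractionRing B kb)
    (A : Subalgebra k K) (hAfg : A.FG) (hAfr : IsFractionRing A K)
    (hBA : ∀ b : B, algebraMap kb K b ∈ A)
    (K₁ : Type u) [Field K₁] [Algebra K K₁]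
    [FiniteDimensional K K₁] (O₁ : ValuationSubring K₁)
    (m : Type u) [Field m] [Algebra kb m] [FiniteDimensional kb m]
    (Om : ValuationSubring m) (hOm : Om.comap (algebraMap kb m) = O.comap (algebraMap kb K))
    (hXS : etaModel kb (nrIn (A.toSubring.map (algebraMap K K₁)))
      (O.comap (algebraMap kb K)).toSubring ≤ O₁.toSubring)
    (hOm' : ∀ c : (O.comap (algebraMap kb K)).toSubring, algebraMap kb m c ∈ Om)
    (hASE : AreSmoothEquivalent
      (etaModelBaseMap (nrIn (A.toSubring.map (algebraMap K K₁)))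
        (O.comap (algebraMap kb K)).toSubring)
      (((algebraMap kb m).comp (O.comap (algebraMap kb K)).toSubring.subtype).codRestrict Om hOm')
      ((maximalIdeal O₁).comap (Subring.inclusion hXS)) (maximalIdeal Om)) :
    ∃ B₁ : Subalgebra k kb, B ≤ B₁ ∧ B₁.FG ∧
      B₁.toSubring ≤ (O.comap (algebraMap kb K)).toSubring ∧
      ∀ B' : Subalgebra k kb, B₁ ≤ B' → B'.FG →
        B'.toSubring ≤ (O.comap (algebraMap kb K)).toSubring →
        ∃ (hX : etaModel kb (nrIn (A.toSubring.map (algebraMap K K₁))) B'.toSubring ≤ O₁.toSubring)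
          (hY : etaModel kb (nrIn (B.toSubring.map (algebraMap kb m))) B'.toSubring ≤ Om.toSubring),
          AreSmoothEquivalent
            (etaModelBaseMap (nrIn (A.toSubring.map (algebraMap K K₁))) B'.toSubring)
            (etaModelBaseMap (nrIn (B.toSubring.map (algebraMap kb m))) B'.toSubring)
            ((maximalIdeal O₁).comap (Subring.inclusion hX))
            ((maximalIdeal Om).comap (Subring.inclusion hY)) := by
  classical
  set Ob : ValuationSubring kb := O.comap (algebraMap kb K) with hObdef
  set R₀ : Subring kb := Ob.toSubring with hR₀def
  set C : Subring K₁ := nrIn (A.toSubring.map (algebraMap K K₁)) with hCdef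
  set C' : Subring m := nrIn (B.toSubring.map (algebraMap kb m)) with hC'def
  -- `k`-structures on `K₁` and `m`
  letI : Algebra k K₁ := ((algebraMap K K₁).comp (algebraMap k K)).toAlgebra
  haveI : IsScalarTower k K K₁ := IsScalarTower.of_algebraMap_eq fun _ => rfl
  haveI : IsScalarTower k kb K₁ := IsScalarTower.of_algebraMap_eq fun c => rfl
  letI : Algebra k m := ((algebraMap kb m).comp (algebraMap k kb)).toAlgebra
  haveI : IsScalarTower k kb m := IsScalarTower.of_algebraMap_eq fun _ => rfl
  have hBfrac : ∀ z : kb, ∃ a ∈ B.toSubring, ∃ b ∈ B.toSubring, z = a / b := fun z => by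
    haveI := hBfr
    obtain ⟨a, b, -, rfl⟩ := IsFractionRing.div_surjective (A := B) z
    exact ⟨a, a.2, b, b.2, rfl⟩
  ------------------------------------------------------------------
  -- the index set: all affine refinements `Y_α = Spec B_α` of `Y` (`B ≤ B_α ⊆ k̄°` f.g.)
  ------------------------------------------------------------------
  let Oalg : Subalgebra k kb :=
    { R₀.toSubsemiring with
      algebraMap_mem' := fun c => hBO (B.algebraMap_mem c) }
  have hOalg : ∀ {S : Subalgebra k kb}, S.toSubring ≤ R₀ ↔ S ≤ Oalg := fun {S} =>
    ⟨fun h x hx => h hx, fun h x hx => h hx⟩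
  let ι : Type u := {B' : Subalgebra k kb // B ≤ B' ∧ B'.FG ∧ B'.toSubring ≤ R₀}
  haveI : IsDirected ι (· ≤ ·) := ⟨fun a b =>
    ⟨⟨a.1 ⊔ b.1, le_sup_of_le_left a.2.1, a.2.2.1.sup b.2.2.1,
      hOalg.mpr (sup_le (hOalg.mp a.2.2.2) (hOalg.mp b.2.2.2))⟩,
      (le_sup_left : a.1 ≤ a.1 ⊔ b.1), (le_sup_right : b.1 ≤ a.1 ⊔ b.1)⟩⟩
  let α₀ : ι := ⟨B, le_rfl, hBfg, hBO⟩
  have hα₀ : ∀ α : ι, α₀ ≤ α := fun α => α.2.1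
  let Bf : ι → Subring kb := fun α => α.1.toSubring
  have hBmono : Monotone Bf := fun a b h x hx => h hx
  have hNoeth : IsNoetherianRing (Bf α₀) := by
    haveI : Algebra.FiniteType k B := (Subalgebra.fg_iff_finiteType B).mp hBfg
    have : IsNoetherianRing B := Algebra.FiniteType.isNoetherianRing k B
    exact this
  have hfrac : ∀ α : ι, ∀ z : kb, ∃ a ∈ Bf α, ∃ b ∈ Bf α, z = a / b := fun α z => by
    obtain ⟨a, ha, b, hb, rfl⟩ := hBfrac z
    exact ⟨a, α.2.1 ha, b, α.2.1 hb, rfl⟩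
  have hBR : ∀ α : ι, Bf α ≤ R₀ := fun α => α.2.2.2
  have hexh : ∀ r ∈ R₀, ∃ α : ι, r ∈ Bf α := fun r hr => by
    have hfg : (Algebra.adjoin k ({r} : Set kb)).FG := ⟨{r}, by rw [Finset.coe_singleton]⟩
    refine ⟨⟨B ⊔ Algebra.adjoin k {r}, le_sup_left, hBfg.sup hfg, hOalg.mpr (sup_le (hOalg.mp hBO)
      (Algebra.adjoin_le (Set.singleton_subset_iff.mpr hr)))⟩, ?_⟩
    exact (le_sup_right : Algebra.adjoin k {r} ≤ B ⊔ Algebra.adjoin k {r})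
      (Algebra.subset_adjoin (Set.mem_singleton r))
  ------------------------------------------------------------------
  -- the model `X̄₀ = Spec C`, `C = Nr_{K₁}(A)`, and its generic fibre
  ------------------------------------------------------------------
  obtain ⟨NA, hNAset, hNAfg, -, -⟩ := exists_normalisation_in_extension A hAfg hAfr K₁
  have hmemNA : ∀ x : K₁, x ∈ NA ↔ IsIntegral (A.map (IsScalarTower.toAlgHom k K K₁)) x :=
    fun x => by rw [← SetLike.mem_coe, hNAset]; rfl
  have hCNA : C = NA.toSubring := by
    ext x
    rw [hCdef, mem_nrIn_iff, isIntegral_subringMap_iff A x]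
    change _ ↔ x ∈ NA
    rw [hmemNA, isIntegral_map_iff A x]
  have hBC : B.toSubring.map (algebraMap kb K₁) ≤ C := by
    rintro _ ⟨b, hb, rfl⟩
    refine le_nrIn _ ⟨algebraMap kb K b, hBA ⟨b, hb⟩, ?_⟩
    exact (IsScalarTower.algebraMap_apply kb K K₁ b).symm
  have hCn : ∀ x : K₁, IsIntegral C x → x ∈ C := fun x hx => by
    rw [hCdef, ← nrIn_nrIn]; exact mem_nrIn_iff.mpr hx
  obtain ⟨s, hs⟩ := hNAfg
  have hCcl : C = Subring.closure (↑((Bf α₀).map (algebraMap kb K₁)) ∪ ↑s) := by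
    refine le_antisymm ?_ ?_
    · rw [hCNA, show NA.toSubring = (Algebra.adjoin k (s : Set K₁)).toSubring by rw [hs],
        Algebra.adjoin_eq_ring_closure]
      refine Subring.closure_mono (Set.union_subset_union_left _ ?_)
      rintro _ ⟨c, rfl⟩
      exact ⟨algebraMap k kb c, B.algebraMap_mem c, (IsScalarTower.algebraMap_apply k kb K₁ c).symm⟩
    · rw [Subring.closure_le]
      refine Set.union_subset hBC ?_
      rw [hCNA, ← hs]
      exact Algebra.subset_adjoin
  have hCgen : ∀ z : K₁, IsIntegral (Algebra.adjoin kb (C : Set K₁)) z →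
      z ∈ Algebra.adjoin kb (C : Set K₁) := fun z hz =>
    mem_adjoin_of_isIntegral_adjoin B.toSubring hBfrac C hBC hCn hz
  ------------------------------------------------------------------
  -- the model `Ȳ₀ = Spec C′`, `C′ = Nr_m(B)`, and its generic fibre
  ------------------------------------------------------------------
  obtain ⟨NB, hNBset, hNBfg, -, -⟩ := exists_normalisation_in_extension B hBfg hBfr m
  have hmemNB : ∀ x : m, x ∈ NB ↔ IsIntegral (B.map (IsScalarTower.toAlgHom k kb m)) x :=
    fun x => by rw [← SetLike.mem_coe, hNBset]; rfl
  have hC'NB : C' = NB.toSubring := by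
    ext x
    rw [hC'def, mem_nrIn_iff, isIntegral_subringMap_iff B x]
    change _ ↔ x ∈ NB
    rw [hmemNB, isIntegral_map_iff B x]
  have hBC' : B.toSubring.map (algebraMap kb m) ≤ C' := le_nrIn _
  have hC'n : ∀ x : m, IsIntegral C' x → x ∈ C' := fun x hx => by
    rw [hC'def, ← nrIn_nrIn]; exact mem_nrIn_iff.mpr hx
  obtain ⟨s', hs'⟩ := hNBfg
  have hC'cl : C' = Subring.closure (↑((Bf α₀).map (algebraMap kb m)) ∪ ↑s') := by
    refine le_antisymm ?_ ?_
    · rw [hC'NB, show NB.toSubring = (Algebra.adjoin k (s' : Set m)).toSubring by rw [hs'],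
        Algebra.adjoin_eq_ring_closure]
      refine Subring.closure_mono (Set.union_subset_union_left _ ?_)
      rintro _ ⟨c, rfl⟩
      exact ⟨algebraMap k kb c, B.algebraMap_mem c, rfl⟩
    · rw [Subring.closure_le]
      refine Set.union_subset hBC' ?_
      rw [hC'NB, ← hs']
      exact Algebra.subset_adjoin
  have hC'gen : ∀ z : m, IsIntegral (Algebra.adjoin kb (C' : Set m)) z →
      z ∈ Algebra.adjoin kb (C' : Set m) := fun z hz =>
    mem_adjoin_of_isIntegral_adjoin B.toSubring hBfrac C' hBC' hC'n hz
  ------------------------------------------------------------------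
  -- `S₁` is open in `Nr_m(S)`: the smooth-equivalence with `Y_S = Nr_m(C′·k̄°)`
  ------------------------------------------------------------------
  have hC'Om : C' ≤ Om.toSubring := by
    refine nrIn_le_valuationSubring Om ?_
    rintro _ ⟨b, hb, rfl⟩
    exact hOm' ⟨b, hBO hb⟩
  obtain ⟨hYS, hsmooth⟩ :=
    exists_smooth_etaModel Ob (ringKrullDim_lt_top_of_le_one hdim) Om hOm C' hC'Om
  letI algYS : Algebra (etaModel kb C' R₀) Om := (Subring.inclusion hYS).toAlgebra
  haveI : Algebra.Smooth (etaModel kb C' R₀) Om := hsmooth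
  set x : Ideal (etaModel kb C R₀) := (maximalIdeal O₁).comap (Subring.inclusion hXS) with hxdef
  set y : Ideal (etaModel kb C' R₀) := (maximalIdeal Om).comap (Subring.inclusion hYS) with hydef
  haveI hxP : x.IsPrime := Ideal.comap_isPrime _ _
  haveI hyP : y.IsPrime := Ideal.comap_isPrime _ _
  have hASE₂ : AreSmoothEquivalent (etaModelBaseMap C R₀) (etaModelBaseMap C' R₀) x y := by
    have hcomp : (algebraMap (etaModel kb C' R₀) Om).comp (etaModelBaseMap C' R₀) =
        ((algebraMap kb m).comp R₀.subtype).codRestrict Om hOm' :=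
      RingHom.ext fun _ => Subtype.ext rfl
    have h1 : AreSmoothEquivalent (etaModelBaseMap C R₀)
        ((algebraMap (etaModel kb C' R₀) Om).comp (etaModelBaseMap C' R₀)) x (maximalIdeal Om) := by
      rw [hcomp]; exact hASE
    exact AreSmoothEquivalent.of_smooth_right h1
  ------------------------------------------------------------------
  -- Lemma 2.8.4
  ------------------------------------------------------------------
  obtain ⟨α₁, hα₁⟩ := Temkin2013_Lemma284_holds ι α₀ hα₀ kb K₁ m Bf hBmono hNoeth hfrac R₀ hBR
    hexh C s hCcl hCgen C' s' hC'cl hC'gen x y hxP hyP hASE₂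
  refine ⟨α₁.1, α₁.2.1, α₁.2.2.1, α₁.2.2.2, fun B' hB₁B' hB'fg hB'O => ?_⟩
  let α : ι := ⟨B', α₁.2.1.trans hB₁B', hB'fg, hB'O⟩
  have hα : α₁ ≤ α := hB₁B'
  have hX : etaModel kb C B'.toSubring ≤ O₁.toSubring := (etaModel_mono C (hBR α)).trans hXS
  have hY : etaModel kb C' B'.toSubring ≤ Om.toSubring := (etaModel_mono C' (hBR α)).trans hYS
  refine ⟨hX, hY, ?_⟩
  have key := hα₁ α hα
  have hx' : x.comap (Subring.inclusion (etaModel_mono C (hBR α))) =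
      (maximalIdeal O₁).comap (Subring.inclusion hX) := by
    ext z
    have hz : Subring.inclusion hXS (Subring.inclusion (etaModel_mono C (hBR α)) z) =
        Subring.inclusion hX z := Subtype.ext (by simp only [Subring.coe_inclusion])
    simp only [hxdef, Ideal.mem_comap, hz]
  have hy' : y.comap (Subring.inclusion (etaModel_mono C' (hBR α))) =
      (maximalIdeal Om).comap (Subring.inclusion hY) := by
    ext z
    have hz : Subring.inclusion hYS (Subring.inclusion (etaModel_mono C' (hBR α)) z) =
        Subring.inclusion hY z := Subtype.ext (by simp only [Subring.coe_inclusion])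
    simp only [hydef, Ideal.mem_comap, hz]
  rw [hx', hy'] at key
  exact key

end stepThree

/-! ### Bricks for Step 4 -/

section bricksFour

/-- **Compositum with a finite purely inseparable extension.** For fields `F ⊆ E` and a finite
purely inseparable extension `k′/F` there is a field `E′ ⊇ E`, finite and purely inseparable over
`E`, with a compatible embedding `k′ → E′` whose image generates `E′` over `E` (the compositum
`E′ = k′E`, constructed inside an algebraic closure of `E`; Temkin 2013, Thm. 4.1.1: "fields
`Lᵢ = LKᵢ`"). Overlaps `exists_compositum` of `InseparableLocalUniformizationStepFour.lean`, which
packages the compositum as an intermediate field of a given `Ω ⊇ E`; here `E′` is abstract and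
carries no instances besides `Field`/`Algebra E E′`, which keeps instance search in Step 4 small.
[folklore] -/
theorem exists_purelyInseparable_compositum (F E k' : Type u) [Field F] [Field E] [Field k'] [Algebra F E]
    [Algebra F k'] [FiniteDimensional F k'] [IsPurelyInseparable F k'] :
    ∃ (E' : Type u) (_ : Field E') (_ : Algebra E E') (ψ : k' →+* E'),
      (∀ c : F, ψ (algebraMap F k' c) = algebraMap E E' (algebraMap F E c)) ∧
      FiniteDimensional E E' ∧ IsPurelyInseparable E E' ∧
      Algebra.adjoin E (Set.range ψ) = ⊤ := by
  classical
  let Ω : Type u := AlgebraicClosure E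
  haveI : Algebra.IsAlgebraic F k' := Algebra.IsAlgebraic.of_finite F k'
  let φ : k' →ₐ[F] Ω := IsAlgClosed.lift
  let bl := Module.finBasis F k'
  let S : Set Ω := Set.range (φ ∘ bl)
  have hSfin : S.Finite := Set.finite_range _
  have hSint : ∀ x ∈ S, IsIntegral E x := by
    rintro _ ⟨i, rfl⟩
    have h1 : IsIntegral F (bl i) := Algebra.IsIntegral.isIntegral (bl i)
    exact (h1.map φ).tower_top
  let Lf : IntermediateField E Ω := IntermediateField.adjoin E S
  haveI : FiniteDimensional E Lf := IntermediateField.finiteDimensional_adjoin hSint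
  obtain ⟨q, hq⟩ := ExpChar.exists F
  haveI : ExpChar E q := expChar_of_injective_algebraMap (algebraMap F E).injective q
  have hLpi : IsPurelyInseparable E Lf := by
    rw [IntermediateField.isPurelyInseparable_adjoin_iff_pow_mem E Ω q]
    rintro _ ⟨i, rfl⟩
    obtain ⟨n, y, hy⟩ := IsPurelyInseparable.pow_mem F q (bl i)
    refine ⟨n, algebraMap F E y, ?_⟩
    show algebraMap E Ω (algebraMap F E y) = (φ (bl i)) ^ q ^ n
    rw [← IsScalarTower.algebraMap_apply F E Ω, ← map_pow, ← hy, AlgHom.commutes]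
  have hrange : ∀ a : k', φ a ∈ Lf := by
    intro a
    have ha : a ∈ Submodule.span F (Set.range bl) := by rw [bl.span_eq]; trivial
    refine Submodule.span_induction ?_ ?_ ?_ ?_ ha
    · rintro _ ⟨i, rfl⟩
      exact IntermediateField.subset_adjoin E S ⟨i, rfl⟩
    · rw [map_zero]; exact zero_mem _
    · intro a b _ _ ha hb
      rw [map_add]; exact add_mem ha hb
    · intro c a _ ha
      rw [map_smul, Algebra.smul_def, IsScalarTower.algebraMap_apply F E Ω]
      exact mul_mem (IntermediateField.algebraMap_mem Lf _) ha
  let ψ : k' →+* Lf := (φ : k' →+* Ω).codRestrict Lf.toSubring hrange |>.comp (RingHom.id k')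
  have hψ : ∀ a : k', ((ψ a : Lf) : Ω) = φ a := fun _ => rfl
  refine ⟨Lf, inferInstance, inferInstance, ψ, fun c => ?_, inferInstance, hLpi, ?_⟩
  · apply Subtype.ext
    rw [hψ, AlgHom.commutes, ← IsScalarTower.algebraMap_apply,
      IsScalarTower.algebraMap_apply F E Lf]
    rfl
  · refine eq_top_iff.mpr fun w _ => ?_
    have hw : (w : Ω) ∈ (IntermediateField.adjoin E S).toSubalgebra := w.2
    rw [IntermediateField.adjoin_toSubalgebra_of_isAlgebraic
      (fun x hx => (hSint x hx).isAlgebraic)] at hw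
    have hmap : (Algebra.adjoin E (Set.range ψ)).map (IntermediateField.val Lf) =
        Algebra.adjoin E ((IntermediateField.val Lf) '' Set.range ψ) := AlgHom.map_adjoin _ _
    have hSsub : S ⊆ (IntermediateField.val Lf) '' Set.range ψ := by
      rintro _ ⟨i, rfl⟩
      exact ⟨ψ (bl i), ⟨bl i, rfl⟩, rfl⟩
    have hw' : (w : Ω) ∈ (Algebra.adjoin E (Set.range ψ)).map (IntermediateField.val Lf) := by
      rw [hmap]
      exact Algebra.adjoin_mono hSsub hw
    obtain ⟨w', hw', hww'⟩ := Subalgebra.mem_map.mp hw'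
    have : w' = w := Subtype.ext hww'
    rwa [← this]

/-- Smoothness at a prime is invariant under isomorphisms of algebras. [folklore] -/
theorem isSmoothAt_comap_algEquiv {R A B : Type*} [CommRing R] [CommRing A] [CommRing B]
    [Algebra R A] [Algebra R B] (e : A ≃ₐ[R] B) (q : Ideal B) [q.IsPrime] :
    Algebra.IsSmoothAt R (q.comap (e : A →+* B)) ↔ Algebra.IsSmoothAt R q := by
  set p : Ideal A := q.comap (e : A →+* B) with hp
  -- `A_p ≃ₐ[R] B_q`
  have hmap : p.primeCompl.map (e : A →+* B).toMonoidHom = q.primeCompl := by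
    ext b
    constructor
    · rintro ⟨a, ha, rfl⟩
      exact ha
    · intro hb
      refine ⟨e.symm b, ?_, by simp⟩
      show e.symm b ∉ p
      rw [hp, Ideal.mem_comap]
      simpa using hb
  let f : Localization.AtPrime p ≃+* Localization.AtPrime q :=
    IsLocalization.ringEquivOfRingEquiv (M := p.primeCompl) (T := q.primeCompl)
      (Localization.AtPrime p) (Localization.AtPrime q) (e : A ≃+* B) hmap
  have hf : ∀ c : R, f (algebraMap R (Localization.AtPrime p) c) =
      algebraMap R (Localization.AtPrime q) c := fun c => by
    rw [IsScalarTower.algebraMap_apply R A (Localization.AtPrime p),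
      IsScalarTower.algebraMap_apply R B (Localization.AtPrime q)]
    have h1 := IsLocalization.ringEquivOfRingEquiv_eq (M := p.primeCompl) (T := q.primeCompl)
      (S := Localization.AtPrime p) (Q := Localization.AtPrime q) (j := (e : A ≃+* B)) hmap
      (algebraMap R A c)
    refine h1.trans ?_
    congr 1
    exact e.commutes c
  let f' : Localization.AtPrime p ≃ₐ[R] Localization.AtPrime q := AlgEquiv.ofRingEquiv (f := f) hf
  exact ⟨fun h => Algebra.FormallySmooth.of_equiv f', fun h => Algebra.FormallySmooth.of_equiv f'.symm⟩

/-- **Formal smoothness does not depend on the copy of the ground field**: if `R → A` is a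
bijective ring map (e.g. an isomorphism of fields) and `B` is an `A`-algebra, then `B` is
formally smooth over `R` iff it is formally smooth over `A`. [folklore] -/
theorem formallySmooth_iff_of_bijective_algebraMap {R A B : Type*} [CommRing R] [CommRing A]
    [CommRing B] [Algebra R A] [Algebra A B] [Algebra R B] [IsScalarTower R A B]
    (h : Function.Bijective (algebraMap R A)) :
    Algebra.FormallySmooth R B ↔ Algebra.FormallySmooth A B := by
  let e : R ≃ₐ[R] A := AlgEquiv.ofBijective (Algebra.ofId R A) h
  haveI : Algebra.FormallySmooth R A := Algebra.FormallySmooth.of_equiv e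
  haveI : Algebra.FormallyUnramified R A := Algebra.FormallyUnramified.of_equiv e
  exact ⟨fun _ => Algebra.FormallySmooth.of_restrictScalars (R := R) (A := A) (B := B),
    fun _ => Algebra.FormallySmooth.comp R A B⟩

/-- **Smoothness at a prime is invariant under isomorphism of pairs** `(R → A) ≅ (R′ → A′)`:
compatible ring isomorphisms `R ≃ R′`, `A ≃ A′` identify `R`-smoothness of `A` at the prime
corresponding to `P′` with `R′`-smoothness of `A′` at `P′`. (Contains `isSmoothAt_of_ringEquiv_base`
of `InseparableLocalUniformizationStepFour.lean`, the case `eA = RingEquiv.refl A`.) [folklore] -/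
theorem isSmoothAt_iff_of_ringEquiv {R R' A A' : Type*} [CommRing R] [CommRing R'] [CommRing A]
    [CommRing A'] [Algebra R A] [Algebra R' A'] (eR : R ≃+* R') (eA : A ≃+* A')
    (h : ∀ r : R, eA (algebraMap R A r) = algebraMap R' A' (eR r)) (P' : Ideal A') [P'.IsPrime] :
    Algebra.IsSmoothAt R (P'.comap (eA : A →+* A')) ↔ Algebra.IsSmoothAt R' P' := by
  letI : Algebra R R' := eR.toRingHom.toAlgebra
  letI algRA' : Algebra R A' := ((algebraMap R' A').comp eR.toRingHom).toAlgebra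
  haveI : IsScalarTower R R' A' := IsScalarTower.of_algebraMap_eq fun _ => rfl
  let eA' : A ≃ₐ[R] A' := AlgEquiv.ofRingEquiv (f := eA) h
  have h1 : Algebra.IsSmoothAt R (P'.comap (eA : A →+* A')) ↔ Algebra.IsSmoothAt R P' :=
    isSmoothAt_comap_algEquiv eA' P'
  rw [h1]
  exact formallySmooth_iff_of_bijective_algebraMap (R := R) (A := R')
    (B := Localization.AtPrime P') eR.bijective

/-- Smoothness at a prime only depends on the prime (not on the primality witness); transport
along an equality of ideals. [folklore] -/
theorem isSmoothAt_of_eq {R A : Type*} [CommRing R] [CommRing A] [Algebra R A] {p q : Ideal A}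
    [p.IsPrime] [q.IsPrime] (h : p = q) (hp : Algebra.IsSmoothAt R p) : Algebra.IsSmoothAt R q := by
  subst h
  exact hp

end bricksFour

/-! ### Step 4: smoothing `y₁` by Thm. 4.1.1 for `Y`, Lemma 2.8.5 and descent of smoothness -/

section stepFour

variable {k K : Type u} [Field k] [Field K] [Algebra k K]

/-- Integrality over a subring `T ⊆ K₁` (acting on `L ⊇ K₁`) is integrality over its image in
`L`. [folklore] -/
theorem isIntegral_subring_map_iff {K₁ L : Type*} [Field K₁] [Field L] [Algebra K₁ L]
    (T : Subring K₁) (z : L) : IsIntegral (T.map (algebraMap K₁ L)) z ↔ IsIntegral T z := by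
  let f : T →+* T.map (algebraMap K₁ L) :=
    ((algebraMap K₁ L).comp T.subtype).codRestrict _ fun a => ⟨a, a.2, rfl⟩
  letI : Algebra T (T.map (algebraMap K₁ L)) := f.toAlgebra
  haveI : IsScalarTower T (T.map (algebraMap K₁ L)) L := IsScalarTower.of_algebraMap_eq fun _ => rfl
  haveI : Algebra.IsIntegral T (T.map (algebraMap K₁ L)) := ⟨fun t => by
    obtain ⟨_, ⟨a, ha, rfl⟩⟩ := t
    exact isIntegral_algebraMap (R := T) (A := T.map (algebraMap K₁ L)) (x := ⟨a, ha⟩)⟩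
  exact ⟨fun h => isIntegral_trans z h, fun h => h.tower_top⟩

/-- Integrality over `Nr_{K₁}(T)` is integrality over `T` (transitivity). Strictly more general
than `isIntegral_nrIn_map_iff` (`InseparableLocalUniformizationStepFour.lean`: the case
`T = A.map (K → K₁)` for a `k`-subalgebra `A ⊆ K`); the librarian may dedupe in this direction.
[folklore] -/
theorem isIntegral_nrIn_iff {K₁ L : Type*} [Field K₁] [Field L] [Algebra K₁ L]
    (T : Subring K₁) (z : L) : IsIntegral (nrIn T) z ↔ IsIntegral T z := by
  letI : Algebra T (nrIn T) := (Subring.inclusion (le_nrIn T)).toAlgebra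
  haveI : IsScalarTower T (nrIn T) L := IsScalarTower.of_algebraMap_eq fun _ => rfl
  haveI : IsScalarTower T (nrIn T) K₁ := IsScalarTower.of_algebraMap_eq fun _ => rfl
  haveI : Algebra.IsIntegral T (nrIn T) := ⟨fun t =>
    (isIntegral_algHom_iff (IsScalarTower.toAlgHom T (nrIn T) K₁) Subtype.val_injective).mp
      (mem_nrIn_iff.mp t.2)⟩
  exact ⟨fun h => isIntegral_trans z h, fun h => h.tower_top⟩

/-- **Packaging the weak descent conclusion** from first-order data: the compositum `L₁`, the
new ground field `l₁ ≤ L ≤ L₁`, the refinement `A′`, the valuation ring `L₁°`, the normalisation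
`N = Nr_{L₁}(A′)` (as a `k`-subalgebra containing `l₁`), and `l`-smoothness of the centre in ANY
presentation `(l, X′) ≅ (l₁, N)` of the pair (ground field, model). Separated from the main
argument only to keep instance search small. [folklore] -/
theorem descentConclusionWeak_of_data (O : ValuationSubring K) (A : Subalgebra k K)
    (K₁ : Type u) [Field K₁] [Algebra K K₁] (O₁ : ValuationSubring K₁)
    (L₁ : Type u) [Field L₁] [Algebra K₁ L₁] [Algebra K L₁] [Algebra k L₁]
    [IsScalarTower K K₁ L₁] [IsScalarTower k K L₁] [FiniteDimensional K₁ L₁]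
    [IsPurelyInseparable K₁ L₁]
    (l₁ : IntermediateField k L₁) [FiniteDimensional k l₁] [IsPurelyInseparable k l₁]
    (L : IntermediateField K L₁) (hl₁L : (l₁ : Set L₁) ⊆ (L : Set L₁)) [IsPurelyInseparable K L]
    (hadj : Algebra.adjoin K₁ (L : Set L₁) = ⊤)
    (A' : Subalgebra k K) (hAA' : A ≤ A') (hA'O : A'.toSubring ≤ O.toSubring) (hA'fg : A'.FG)
    (hA'fr : IsFractionRing A' K)
    (O₁' : ValuationSubring L₁) (hO₁' : O₁'.comap (algebraMap K₁ L₁) = O₁)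
    (NX : Subalgebra k L₁) (hl₁NX : ∀ c : l₁, (c : L₁) ∈ NX)
    (hNXO : NX.toSubring ≤ O₁'.toSubring)
    (hNXset : (NX : Set L₁) = {x : L₁ | IsIntegral (A'.map (IsScalarTower.toAlgHom k K L₁)) x})
    (hNXfg : NX.FG) (hNXfr : IsFractionRing NX L₁)
    (l X' : Type u) [Field l] [CommRing X'] [Algebra l X'] (eR : l ≃+* l₁) (eA : X' ≃+* NX)
    (heA : ∀ r : l, ((eA (algebraMap l X' r) : NX) : L₁) = ((eR r : l₁) : L₁))
    (x' : Ideal X') [x'.IsPrime] (hx' : Algebra.IsSmoothAt l x')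
    (hx'mem : ∀ z : X', z ∈ x' ↔ (⟨((eA z : NX) : L₁), hNXO (eA z).2⟩ : O₁') ∈ maximalIdeal O₁') :
    Temkin2013DescentConclusionWeak k K O A K₁ O₁ := by
  let N : Subalgebra l₁ L₁ :=
    { NX.toSubsemiring with
      algebraMap_mem' := fun c => hl₁NX c }
  have hmemN : ∀ z : L₁, z ∈ N ↔ z ∈ NX := fun _ => Iff.rfl
  have hN : N.toSubring ≤ O₁'.toSubring := fun z hz => hNXO ((hmemN z).mp hz)
  have hNset : (N : Set L₁) = {x : L₁ | IsIntegral (A'.map (IsScalarTower.toAlgHom k K L₁)) x} :=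
    hNXset
  have hNfg : (N.restrictScalars k).FG := by
    have : N.restrictScalars k = NX := SetLike.ext fun z => hmemN z
    rw [this]; exact hNXfg
  have hNfr : IsFractionRing N L₁ := hNXfr
  let eN : X' ≃+* N :=
    { toFun := fun z => ⟨(eA z : L₁), (eA z).2⟩
      invFun := fun z => eA.symm ⟨(z : L₁), z.2⟩
      left_inv := fun z => by
        change eA.symm ⟨(eA z : L₁), (eA z).2⟩ = z
        simp
      right_inv := fun z => by
        apply Subtype.ext
        change ((eA (eA.symm ⟨(z : L₁), z.2⟩) : NX) : L₁) = z
        simp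
      map_mul' := fun a b => Subtype.ext (by
        change ((eA (a * b) : NX) : L₁) = (eA a : L₁) * (eA b : L₁)
        rw [map_mul]; rfl)
      map_add' := fun a b => Subtype.ext (by
        change ((eA (a + b) : NX) : L₁) = (eA a : L₁) + (eA b : L₁)
        rw [map_add]; rfl) }
  have heN : ∀ r : l, eN (algebraMap l X' r) = algebraMap l₁ N (eR r) := fun r =>
    Subtype.ext (heA r)
  have hP : (centreIdeal N O₁' hN).comap (eN : X' →+* N) = x' := by
    ext z
    rw [Ideal.mem_comap, hx'mem]
    rfl
  have hsmN : Algebra.IsSmoothAt l₁ (centreIdeal N O₁' hN) :=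
    (isSmoothAt_iff_of_ringEquiv eR eN heN (centreIdeal N O₁' hN)).mp (isSmoothAt_of_eq hP.symm hx')
  exact ⟨L₁, inferInstance, inferInstance, inferInstance, inferInstance, inferInstance,
    inferInstance, inferInstance, inferInstance, l₁, inferInstance, inferInstance, L, hl₁L,
    inferInstance, hadj, A', hAA', hA'O, hA'fg, hA'fr, O₁', hO₁', N, hN, hNset, hNfg, hNfr, hsmN⟩

-- one long proof through the fields `k ⊆ k̄ ⊆ K ⊆ K₁ ⊆ L₁`, `k̄ ⊆ m ⊆ m' ⊇ l`
set_option maxHeartbeats 800000 in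
/-- **Step 4 of the proof of Thm. 4.1.1 (without the final "simple" clause)**, PROVED from
Lemma 2.8.5 (`Temkin2013_Lemma285_normal_holds`) and descent of `l`-smoothness along smooth
covers over a field (`AreSmoothEquivalent.isSmoothAt_left_of_field'`). See
`Temkin2013_Steps34_tower` for the text. Data: the level `Y′ = Spec B′` reached after Step 3 (the
centre `x_{1,B′}` of `K₁°` on `X_{1,B′} = Nr_{K₁}(Nr_{K₁}(A)·B′)` smooth-equivalent over `B′` to the
centre `y_{1,B′}` of `m°` on `Y_{1,B′} = Nr_m(Nr_m(B)·B′)`), chosen such that Thm. 4.1.1 for `Y`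
has ALREADY smoothed `y₁` at this level: a finite purely inseparable `m′ = L^Y m ⊇ L^Y ⊇ l`, the
valuation ring `m′°` and `l`-smoothness of the centre of `m′°` on `Nr_{m′}(B′)`. Conclusion: the
weak descent conclusion for `(K, X, K₁)`, with `L₁ = L^Y K₁`, `X′ = Spec k[A ∪ B′]`.
[cite: Temkin2013, proof of Thm. 4.1.1 Step 4 (arXiv:0804.1554v3 p. 49)] -/
theorem descentConclusionWeak_of_level (O : ValuationSubring K) (hk : ∀ c : k, algebraMap k K c ∈ O)
    (kb : IntermediateField k K) (B : Subalgebra k kb)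
    (A : Subalgebra k K) (hAO : A.toSubring ≤ O.toSubring) (hAfg : A.FG)
    (hAfr : IsFractionRing A K)
    (K₁ : Type u) [Field K₁] [Algebra K K₁] [FiniteDimensional K K₁]
    (O₁ : ValuationSubring K₁) (hO₁ : O₁.comap (algebraMap K K₁) = O)
    (m : Type u) [Field m] [Algebra kb m] [FiniteDimensional kb m]
    (Om : ValuationSubring m)
    (C : Subring K₁) (hC : C = nrIn (A.toSubring.map (algebraMap K K₁)))
    (C' : Subring m) (hC' : C' = nrIn (B.toSubring.map (algebraMap kb m)))
    (B' : Subalgebra k kb) (hBB' : B ≤ B') (hB'fg : B'.FG)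
    (hB'O : B'.toSubring ≤ (O.comap (algebraMap kb K)).toSubring) (hB'fr : IsFractionRing B' kb)
    (hX : etaModel kb C B'.toSubring ≤ O₁.toSubring)
    (hY : etaModel kb C' B'.toSubring ≤ Om.toSubring)
    (hSE : AreSmoothEquivalent (etaModelBaseMap C B'.toSubring) (etaModelBaseMap C' B'.toSubring)
      ((maximalIdeal O₁).comap (Subring.inclusion hX))
      ((maximalIdeal Om).comap (Subring.inclusion hY)))
    (m' : Type u) [Field m'] [Algebra m m'] [Algebra kb m'] [Algebra k m']
    [IsScalarTower kb m m'] [IsScalarTower k kb m'] [FiniteDimensional m m']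
    (l : IntermediateField k m') [FiniteDimensional k l] [IsPurelyInseparable k l]
    (LY : IntermediateField kb m') (hlLY : (l : Set m') ⊆ LY) [IsPurelyInseparable kb LY]
    (hadjY : Algebra.adjoin m (LY : Set m') = ⊤)
    (Om' : ValuationSubring m') (hOm' : Om'.comap (algebraMap m m') = Om)
    (NY : Subalgebra l m') (hNY : NY.toSubring ≤ Om'.toSubring)
    (hNYint : (NY : Set m') = {x : m' | IsIntegral (B'.map (IsScalarTower.toAlgHom k kb m')) x})
    (hsmY : Algebra.IsSmoothAt l (centreIdeal NY Om' hNY)) :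
    Temkin2013DescentConclusionWeak k K O A K₁ O₁ := by
  classical
  ------------------------------------------------------------------
  -- scalar structures
  ------------------------------------------------------------------
  haveI : FiniteDimensional kb m' := Module.Finite.trans m m'
  haveI : FiniteDimensional kb LY := inferInstance
  letI : Algebra k K₁ := ((algebraMap K K₁).comp (algebraMap k K)).toAlgebra
  haveI : IsScalarTower k K K₁ := IsScalarTower.of_algebraMap_eq fun _ => rfl
  haveI : IsScalarTower k kb K₁ := IsScalarTower.of_algebraMap_eq fun _ => rfl
  letI : Algebra k m := ((algebraMap kb m).comp (algebraMap k kb)).toAlgebra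
  haveI : IsScalarTower k kb m := IsScalarTower.of_algebraMap_eq fun _ => rfl
  haveI : IsScalarTower k m m' := IsScalarTower.of_algebraMap_eq fun c => by
    show algebraMap k m' c = algebraMap m m' (algebraMap kb m (algebraMap k kb c))
    rw [← IsScalarTower.algebraMap_apply kb m m', ← IsScalarTower.algebraMap_apply k kb m']
  obtain ⟨q, hq⟩ := ExpChar.exists k
  haveI := hq
  haveI hqkb : ExpChar kb q := expChar_of_injective_algebraMap (algebraMap k kb).injective q
  haveI hqK : ExpChar K q := expChar_of_injective_algebraMap (algebraMap k K).injective q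
  haveI hqK₁ : ExpChar K₁ q := expChar_of_injective_algebraMap (algebraMap K K₁).injective q
  have hB'frac : ∀ z : kb, ∃ a ∈ B'.toSubring, ∃ b ∈ B'.toSubring, z = a / b := fun z => by
    haveI := hB'fr
    obtain ⟨a, b, -, rfl⟩ := IsFractionRing.div_surjective (A := B') z
    exact ⟨a, a.2, b, b.2, rfl⟩
  ------------------------------------------------------------------
  -- the normal models `X_{1,B′}` and `Y_{1,B′}`
  ------------------------------------------------------------------
  have hAC : A.toSubring.map (algebraMap K K₁) ≤ C := by rw [hC]; exact le_nrIn _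
  have hCX : C ≤ etaModel kb C B'.toSubring := le_etaModel _ _
  have hB'X : B'.toSubring.map (algebraMap kb K₁) ≤ etaModel kb C B'.toSubring := map_le_etaModel _ _
  have hXn : ∀ z : K₁, IsIntegral (etaModel kb C B'.toSubring) z → z ∈ etaModel kb C B'.toSubring :=
    fun z hz => mem_etaModel_of_isIntegral C B'.toSubring hz
  have hBC' : B.toSubring.map (algebraMap kb m) ≤ C' := by rw [hC']; exact le_nrIn _
  have hC'Y : C' ≤ etaModel kb C' B'.toSubring := le_etaModel _ _
  have hB'Y : B'.toSubring.map (algebraMap kb m) ≤ etaModel kb C' B'.toSubring := map_le_etaModel _ _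
  have hYn : ∀ z : m, IsIntegral (etaModel kb C' B'.toSubring) z → z ∈ etaModel kb C' B'.toSubring :=
    fun z hz => mem_etaModel_of_isIntegral C' B'.toSubring hz
  haveI hXfr : IsFractionRing (etaModel kb C B'.toSubring) K₁ := by
    haveI := hAfr
    refine IsFractionRing.of_field _ K₁ fun z => ?_
    haveI : Algebra.IsAlgebraic K K₁ := Algebra.IsAlgebraic.of_finite K K₁
    have hz : IsAlgebraic A z :=
      (IsFractionRing.isAlgebraic_iff A K K₁).mpr (Algebra.IsAlgebraic.isAlgebraic z)
    obtain ⟨a, ha0, hint⟩ := hz.exists_integral_multiple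
    have hmem : a • z ∈ etaModel kb C B'.toSubring := by
      refine hCX ?_
      rw [hC, mem_nrIn_iff, isIntegral_subringMap_iff A]
      exact hint
    have ha' : algebraMap A K₁ a ≠ 0 :=
      (map_ne_zero_iff _ (FaithfulSMul.algebraMap_injective A K₁)).mpr ha0
    refine ⟨⟨a • z, hmem⟩, ⟨algebraMap A K₁ a, hCX (hAC ⟨a, a.2, rfl⟩)⟩, ?_⟩
    change z = (a • z) / algebraMap A K₁ a
    rw [Algebra.smul_def, eq_div_iff ha', mul_comm]
  haveI hYfr : IsFractionRing (etaModel kb C' B'.toSubring) m := by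
    haveI := hB'fr
    refine IsFractionRing.of_field _ m fun z => ?_
    haveI : Algebra.IsAlgebraic kb m := Algebra.IsAlgebraic.of_finite kb m
    have hz : IsAlgebraic B' z :=
      (IsFractionRing.isAlgebraic_iff B' kb m).mpr (Algebra.IsAlgebraic.isAlgebraic z)
    obtain ⟨a, ha0, hint⟩ := hz.exists_integral_multiple
    have hmem : a • z ∈ etaModel kb C' B'.toSubring := by
      have h1 : IsIntegral (B'.toSubring.map (algebraMap kb m)) (a • z) :=
        (isIntegral_subringMap_iff B' _).mpr hint
      exact nrIn_mono (le_sup_right (a := C')) (mem_nrIn_iff.mpr h1)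
    have ha' : algebraMap B' m a ≠ 0 :=
      (map_ne_zero_iff _ (FaithfulSMul.algebraMap_injective B' m)).mpr ha0
    refine ⟨⟨a • z, hmem⟩, ⟨algebraMap B' m a, hB'Y ⟨a, a.2, rfl⟩⟩, ?_⟩
    change z = (a • z) / algebraMap B' m a
    rw [Algebra.smul_def, eq_div_iff ha', mul_comm]
  haveI hXic : IsIntegrallyClosed (etaModel kb C B'.toSubring) :=
    (isIntegrallyClosed_iff K₁).mpr fun {z} hz => ⟨⟨z, hXn z hz⟩, rfl⟩
  haveI hYic : IsIntegrallyClosed (etaModel kb C' B'.toSubring) :=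
    (isIntegrallyClosed_iff m).mpr fun {z} hz => ⟨⟨z, hYn z hz⟩, rfl⟩
  -- the base `R₀ = B′` and its structure maps
  letI algRX : Algebra B'.toSubring (etaModel kb C B'.toSubring) :=
    (etaModelBaseMap C B'.toSubring).toAlgebra
  letI algRY : Algebra B'.toSubring (etaModel kb C' B'.toSubring) :=
    (etaModelBaseMap C' B'.toSubring).toAlgebra
  haveI : FaithfulSMul B'.toSubring (etaModel kb C B'.toSubring) :=
    (faithfulSMul_iff_algebraMap_injective _ _).mpr fun a b hab =>
      Subtype.ext ((algebraMap kb K₁).injective (congrArg Subtype.val hab))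
  haveI : FaithfulSMul B'.toSubring (etaModel kb C' B'.toSubring) :=
    (faithfulSMul_iff_algebraMap_injective _ _).mpr fun a b hab =>
      Subtype.ext ((algebraMap kb m).injective (congrArg Subtype.val hab))
  haveI : IsScalarTower B'.toSubring (etaModel kb C B'.toSubring) K₁ :=
    IsScalarTower.of_algebraMap_eq fun _ => rfl
  haveI : IsScalarTower B'.toSubring (etaModel kb C' B'.toSubring) m :=
    IsScalarTower.of_algebraMap_eq fun _ => rfl
  ------------------------------------------------------------------
  -- the compositum `L₁ = L^Y K₁` and the valuation ring `L₁°`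
  ------------------------------------------------------------------
  obtain ⟨L₁, instFL₁, instK₁L₁, ψ, hψ, hfinL₁, hpiL₁, hadjL₁⟩ := exists_purelyInseparable_compositum kb K₁ LY
  haveI := hfinL₁
  letI instLYL₁ : Algebra LY L₁ := ψ.toAlgebra
  letI instKL₁ : Algebra K L₁ := ((algebraMap K₁ L₁).comp (algebraMap K K₁)).toAlgebra
  haveI : IsScalarTower K K₁ L₁ := IsScalarTower.of_algebraMap_eq fun _ => rfl
  letI instkL₁ : Algebra k L₁ := ((algebraMap K L₁).comp (algebraMap k K)).toAlgebra
  haveI : IsScalarTower k K L₁ := IsScalarTower.of_algebraMap_eq fun _ => rfl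
  haveI : IsScalarTower k kb L₁ := IsScalarTower.of_algebraMap_eq fun _ => rfl
  haveI : IsScalarTower k K₁ L₁ := IsScalarTower.of_algebraMap_eq fun _ => rfl
  haveI : IsScalarTower kb K₁ L₁ := IsScalarTower.of_algebraMap_eq fun _ => rfl
  have hψ' : ∀ c : kb, ψ (algebraMap kb LY c) = algebraMap kb L₁ c := hψ
  haveI : IsScalarTower kb LY L₁ := IsScalarTower.of_algebraMap_eq fun c => (hψ' c).symm
  haveI : IsScalarTower B'.toSubring LY L₁ := IsScalarTower.of_algebraMap_eq fun c => (hψ' c).symm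
  haveI : IsScalarTower B'.toSubring K₁ L₁ := IsScalarTower.of_algebraMap_eq fun _ => rfl
  haveI : IsScalarTower (etaModel kb C B'.toSubring) K₁ L₁ := IsScalarTower.of_algebraMap_eq fun _ => rfl
  haveI : IsScalarTower B'.toSubring (etaModel kb C B'.toSubring) L₁ :=
    IsScalarTower.of_algebraMap_eq fun _ => rfl
  haveI : FiniteDimensional K L₁ := Module.Finite.trans K₁ L₁
  have hadjL₁' : Algebra.adjoin K₁ (Set.range (algebraMap LY L₁)) = ⊤ := hadjL₁
  obtain ⟨O₁', hO₁'⟩ := exists_valuationSubring_comap_eq (Ω := L₁) O₁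
  have hO₁'K : O₁'.comap (algebraMap K L₁) = O := by
    rw [IsScalarTower.algebraMap_eq K K₁ L₁, ← ValuationSubring.comap_comap, hO₁', hO₁]
  ------------------------------------------------------------------
  -- `Y`-side structures over `m′`
  ------------------------------------------------------------------
  haveI : IsScalarTower B'.toSubring m m' := IsScalarTower.of_algebraMap_eq fun c =>
    IsScalarTower.algebraMap_apply kb m m' (c : kb)
  haveI : IsScalarTower B'.toSubring LY m' := IsScalarTower.of_algebraMap_eq fun _ => rfl
  haveI : IsScalarTower (etaModel kb C' B'.toSubring) m m' := IsScalarTower.of_algebraMap_eq fun _ => rfl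
  haveI : IsScalarTower B'.toSubring (etaModel kb C' B'.toSubring) m' :=
    IsScalarTower.of_algebraMap_eq fun c => IsScalarTower.algebraMap_apply kb m m' (c : kb)
  have hadjM : Algebra.adjoin m (Set.range (algebraMap LY m')) = ⊤ := by
    have : Set.range (algebraMap LY m') = (LY : Set m') := by
      ext w
      exact ⟨fun ⟨c, hc⟩ => hc ▸ c.2, fun hw => ⟨⟨w, hw⟩, rfl⟩⟩
    rw [this, hadjY]
  ------------------------------------------------------------------
  -- the points and their preimages in the normalizations
  ------------------------------------------------------------------
  set x : Ideal (etaModel kb C B'.toSubring) := (maximalIdeal O₁).comap (Subring.inclusion hX)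
    with hxdef
  set y : Ideal (etaModel kb C' B'.toSubring) := (maximalIdeal Om).comap (Subring.inclusion hY)
    with hydef
  haveI hxP : x.IsPrime := Ideal.comap_isPrime _ _
  haveI hyP : y.IsPrime := Ideal.comap_isPrime _ _
  -- `X′ = Nr_{L₁}(X_{1,B′})`, inside `L₁°`
  have hXO₁ : ∀ a : etaModel kb C B'.toSubring, algebraMap K₁ L₁ a ∈ O₁' := fun a => by
    have : (a : K₁) ∈ O₁'.comap (algebraMap K₁ L₁) := by rw [hO₁']; exact hX a.2
    exact this
  have hX'O : ∀ z : L₁, IsIntegral (etaModel kb C B'.toSubring) z → z ∈ O₁' := fun z hz => by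
    letI : Algebra (etaModel kb C B'.toSubring) O₁' :=
      ((algebraMap K₁ L₁).comp (etaModel kb C B'.toSubring).subtype).codRestrict O₁'.toSubring
        hXO₁ |>.toAlgebra
    haveI : IsScalarTower (etaModel kb C B'.toSubring) O₁' L₁ :=
      IsScalarTower.of_algebraMap_eq fun _ => rfl
    have hz' : IsIntegral O₁' z := hz.tower_top
    obtain ⟨w, rfl⟩ := IsIntegrallyClosed.algebraMap_eq_of_integral hz'
    exact w.2
  let φX : integralClosure (etaModel kb C B'.toSubring) L₁ →+* O₁' :=
    (integralClosure (etaModel kb C B'.toSubring) L₁).val.toRingHom.codRestrict O₁'.toSubring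
      fun z => hX'O z z.2
  have hφX : ∀ z, (φX z : L₁) = z := fun _ => rfl
  set x' : Ideal (integralClosure (etaModel kb C B'.toSubring) L₁) := (maximalIdeal O₁').comap φX
    with hx'def
  haveI hx'P : x'.IsPrime := Ideal.comap_isPrime _ _
  have hcx : x'.comap (algebraMap (etaModel kb C B'.toSubring) _) = x := by
    ext a
    rw [Ideal.mem_comap, hx'def, Ideal.mem_comap, hxdef, Ideal.mem_comap]
    exact mk_algebraMap_mem_maximalIdeal_iff O₁' O₁ hO₁' (a : K₁) (hX a.2) (hXO₁ a)
  -- `Y′ = Nr_{m′}(Y_{1,B′})`, inside `m′°`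
  have hYOm' : ∀ a : etaModel kb C' B'.toSubring, algebraMap m m' a ∈ Om' := fun a => by
    have : (a : m) ∈ Om'.comap (algebraMap m m') := by rw [hOm']; exact hY a.2
    exact this
  have hY'O : ∀ z : m', IsIntegral (etaModel kb C' B'.toSubring) z → z ∈ Om' := fun z hz => by
    letI : Algebra (etaModel kb C' B'.toSubring) Om' :=
      ((algebraMap m m').comp (etaModel kb C' B'.toSubring).subtype).codRestrict Om'.toSubring
        hYOm' |>.toAlgebra
    haveI : IsScalarTower (etaModel kb C' B'.toSubring) Om' m' :=
      IsScalarTower.of_algebraMap_eq fun _ => rfl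
    have hz' : IsIntegral Om' z := hz.tower_top
    obtain ⟨w, rfl⟩ := IsIntegrallyClosed.algebraMap_eq_of_integral hz'
    exact w.2
  let φY : integralClosure (etaModel kb C' B'.toSubring) m' →+* Om' :=
    (integralClosure (etaModel kb C' B'.toSubring) m').val.toRingHom.codRestrict Om'.toSubring
      fun z => hY'O z z.2
  have hφY : ∀ z, (φY z : m') = z := fun _ => rfl
  set y' : Ideal (integralClosure (etaModel kb C' B'.toSubring) m') := (maximalIdeal Om').comap φY
    with hy'def
  haveI hy'P : y'.IsPrime := Ideal.comap_isPrime _ _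
  have hcy : y'.comap (algebraMap (etaModel kb C' B'.toSubring) _) = y := by
    ext a
    rw [Ideal.mem_comap, hy'def, Ideal.mem_comap, hydef, Ideal.mem_comap]
    exact mk_algebraMap_mem_maximalIdeal_iff Om' Om hOm' (a : m) (hY a.2) (hYOm' a)
  ------------------------------------------------------------------
  -- Lemma 2.8.5: `x′` and `y′` are smooth-equivalent over `B′`
  ------------------------------------------------------------------
  haveI : IsFractionRing B'.toSubring kb := hB'fr
  have h285 : AreSmoothEquivalent
      (algebraMap B'.toSubring (integralClosure (etaModel kb C B'.toSubring) L₁))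
      (algebraMap B'.toSubring (integralClosure (etaModel kb C' B'.toSubring) m')) x' y' :=
    Temkin2013_Lemma285_normal_holds B'.toSubring kb LY inferInstance inferInstance
      (etaModel kb C B'.toSubring) K₁ L₁ hadjL₁' (etaModel kb C' B'.toSubring) m m' hadjM
      x y hxP hyP hSE x' y' hx'P hy'P hcx hcy
  ------------------------------------------------------------------
  -- the `l`-structures of `X′` and `Y′`
  ------------------------------------------------------------------
  let kToR : k →+* B'.toSubring :=
    (algebraMap k kb).codRestrict B'.toSubring fun c => B'.algebraMap_mem c
  letI algkX : Algebra k (etaModel kb C B'.toSubring) :=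
    ((algebraMap B'.toSubring (etaModel kb C B'.toSubring)).comp kToR).toAlgebra
  letI algkY : Algebra k (etaModel kb C' B'.toSubring) :=
    ((algebraMap B'.toSubring (etaModel kb C' B'.toSubring)).comp kToR).toAlgebra
  haveI : IsScalarTower k (etaModel kb C B'.toSubring) L₁ :=
    IsScalarTower.of_algebraMap_eq fun _ => rfl
  haveI : IsScalarTower k (etaModel kb C' B'.toSubring) m' :=
    IsScalarTower.of_algebraMap_eq fun c => by
      show algebraMap k m' c = algebraMap m m' (algebraMap kb m (algebraMap k kb c))
      rw [← IsScalarTower.algebraMap_apply kb m m', ← IsScalarTower.algebraMap_apply k kb m']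
  -- `l → L^Y → L₁`
  let lToLY : l →+* LY :=
    { toFun := fun c => ⟨(c : m'), hlLY c.2⟩
      map_one' := rfl
      map_mul' := fun _ _ => rfl
      map_zero' := rfl
      map_add' := fun _ _ => rfl }
  have hlToLY : ∀ c : l, ((lToLY c : LY) : m') = c := fun _ => rfl
  have hlToLYk : ∀ c : k, lToLY (algebraMap k l c) = algebraMap kb LY (algebraMap k kb c) :=
    fun c => Subtype.ext (by
      rw [hlToLY]
      show algebraMap k m' c = ((algebraMap kb LY (algebraMap k kb c) : LY) : m')
      rw [IsScalarTower.algebraMap_apply k kb m' c]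
      rfl)
  let θ : l →+* L₁ := (algebraMap LY L₁).comp lToLY
  have hθk : ∀ c : k, θ (algebraMap k l c) = algebraMap k L₁ c := fun c => by
    show algebraMap LY L₁ (lToLY (algebraMap k l c)) = algebraMap k L₁ c
    rw [hlToLYk, ← IsScalarTower.algebraMap_apply kb LY L₁, ← IsScalarTower.algebraMap_apply]
  let θa : l →ₐ[k] L₁ := { θ with commutes' := hθk }
  have hθint : ∀ c : l, IsIntegral (etaModel kb C B'.toSubring) (θ c) := fun c => by
    have h1 : IsIntegral k (θa c) := (Algebra.IsIntegral.isIntegral (R := k) c).map θa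
    exact h1.tower_top
  have hlint : ∀ c : l, IsIntegral (etaModel kb C' B'.toSubring) (algebraMap l m' c) := fun c => by
    have h1 : IsIntegral k (algebraMap l m' c) :=
      (Algebra.IsIntegral.isIntegral (R := k) c).map (IsScalarTower.toAlgHom k l m')
    exact h1.tower_top
  letI algX' : Algebra l (integralClosure (etaModel kb C B'.toSubring) L₁) :=
    (θ.codRestrict (integralClosure (etaModel kb C B'.toSubring) L₁).toSubring hθint).toAlgebra
  letI algY' : Algebra l (integralClosure (etaModel kb C' B'.toSubring) m') :=
    ((algebraMap l m').codRestrict (integralClosure (etaModel kb C' B'.toSubring) m').toSubring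
      hlint).toAlgebra
  have halgX' : ∀ c : l, ((algebraMap l (integralClosure (etaModel kb C B'.toSubring) L₁) c :
      integralClosure (etaModel kb C B'.toSubring) L₁) : L₁) = θ c := fun _ => rfl
  have halgY' : ∀ c : l, ((algebraMap l (integralClosure (etaModel kb C' B'.toSubring) m') c :
      integralClosure (etaModel kb C' B'.toSubring) m') : m') = algebraMap l m' c := fun _ => rfl
  letI algkX' : Algebra k (integralClosure (etaModel kb C B'.toSubring) L₁) :=
    ((algebraMap l (integralClosure (etaModel kb C B'.toSubring) L₁)).comp (algebraMap k l)).toAlgebra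
  letI algkY' : Algebra k (integralClosure (etaModel kb C' B'.toSubring) m') :=
    ((algebraMap l (integralClosure (etaModel kb C' B'.toSubring) m')).comp (algebraMap k l)).toAlgebra
  haveI : IsScalarTower k l (integralClosure (etaModel kb C B'.toSubring) L₁) :=
    IsScalarTower.of_algebraMap_eq fun _ => rfl
  haveI : IsScalarTower k l (integralClosure (etaModel kb C' B'.toSubring) m') :=
    IsScalarTower.of_algebraMap_eq fun _ => rfl
  ------------------------------------------------------------------
  -- `Y′` is the `l`-variety `Nr_{m′}(B′)` of Thm. 4.1.1 for `Y`: finite type, `y′` is `l`-smooth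
  ------------------------------------------------------------------
  have hYint : Algebra.IsIntegral B'.toSubring (etaModel kb C' B'.toSubring) := by
    refine ⟨fun w => ?_⟩
    have hw : (w : m) ∈ nrIn (B'.toSubring.map (algebraMap kb m)) := by
      have h1 : etaModel kb C' B'.toSubring ≤ nrIn (nrIn (B'.toSubring.map (algebraMap kb m))) := by
        refine nrIn_mono (sup_le ?_ (le_nrIn _))
        rw [hC']
        exact nrIn_mono (fun _ ⟨b, hb, e⟩ => ⟨b, hBB' hb, e⟩)
      rw [nrIn_nrIn] at h1
      exact h1 w.2
    have hw' : IsIntegral (B'.toSubring.map (algebraMap kb m)) (w : m) := mem_nrIn_iff.mp hw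
    have hw'' : IsIntegral B'.toSubring (w : m) := by
      have := (isIntegral_subringMap_iff B' (w : m)).mp hw'
      exact this
    exact (isIntegral_algHom_iff (IsScalarTower.toAlgHom B'.toSubring (etaModel kb C' B'.toSubring) m)
      Subtype.val_injective).mp hw''
  have hmemY' : ∀ z : m', z ∈ NY ↔ IsIntegral (etaModel kb C' B'.toSubring) z := fun z => by
    rw [← SetLike.mem_coe, hNYint, Set.mem_setOf_eq, isIntegral_map_iff B' z]
    constructor
    · intro hz
      have hz' : IsIntegral B'.toSubring z := hz
      exact hz'.tower_top
    · intro hz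
      haveI := hYint
      have : IsIntegral B'.toSubring z := isIntegral_trans z hz
      exact this
  let eY : NY ≃ₐ[l] integralClosure (etaModel kb C' B'.toSubring) m' :=
    { toFun := fun z => ⟨z.1, (hmemY' z.1).mp z.2⟩
      invFun := fun z => ⟨z.1, (hmemY' z.1).mpr z.2⟩
      left_inv := fun _ => rfl
      right_inv := fun _ => rfl
      map_mul' := fun _ _ => rfl
      map_add' := fun _ _ => rfl
      commutes' := fun _ => rfl }
  have heY : ∀ z : NY, ((eY z : integralClosure (etaModel kb C' B'.toSubring) m') : m') = z :=
    fun _ => rfl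
  have hsmY' : Algebra.IsSmoothAt l y' := by
    have he : y'.comap (eY : NY →+* integralClosure (etaModel kb C' B'.toSubring) m') =
        centreIdeal NY Om' hNY := by
      ext z
      rw [Ideal.mem_comap, hy'def, Ideal.mem_comap]
      rfl
    have h1 : Algebra.IsSmoothAt l
        (y'.comap (eY : NY →+* integralClosure (etaModel kb C' B'.toSubring) m')) :=
      isSmoothAt_of_eq he.symm hsmY
    exact (isSmoothAt_comap_algEquiv eY y').mp h1
  ------------------------------------------------------------------
  -- `X′` is the `l`-variety `Nr_{L₁}(X″)`, `X″ = Spec k[A ∪ B′]`: finite type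
  ------------------------------------------------------------------
  obtain ⟨tA, htA⟩ := id hAfg
  obtain ⟨tB, htB⟩ := id hB'fg
  have htAA : (tA : Set K) ⊆ A := by rw [← htA]; exact Algebra.subset_adjoin
  have htBB : (tB : Set kb) ⊆ B' := by rw [← htB]; exact Algebra.subset_adjoin
  set A' : Subalgebra k K := Algebra.adjoin k (↑tA ∪ ↑(tB.image fun b : kb => (b : K)))
    with hA'def
  have hAA' : A ≤ A' := by
    rw [← htA]; exact Algebra.adjoin_mono Set.subset_union_left
  have hB'A' : ∀ b : kb, b ∈ B' → (b : K) ∈ A' := fun b hb => by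
    have hb' : b ∈ Algebra.adjoin k (tB : Set kb) := by rw [htB]; exact hb
    have hmap : (Algebra.adjoin k (tB : Set kb)).map (IsScalarTower.toAlgHom k kb K) ≤ A' := by
      rw [AlgHom.map_adjoin]
      refine Algebra.adjoin_mono ?_
      rintro _ ⟨c, hc, rfl⟩
      exact Or.inr (Finset.mem_coe.mpr (Finset.mem_image.mpr ⟨c, hc, rfl⟩))
    exact hmap ⟨b, hb', rfl⟩
  let Oalg : Subalgebra k K := { O.toSubring.toSubsemiring with algebraMap_mem' := hk }
  have hA'O : A'.toSubring ≤ O.toSubring := by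
    have : A' ≤ Oalg := by
      refine Algebra.adjoin_le (Set.union_subset (htAA.trans hAO) ?_)
      intro z hz
      obtain ⟨b, hb, rfl⟩ := Finset.mem_image.mp (Finset.mem_coe.mp hz)
      exact hB'O (htBB hb)
    exact fun z hz => this hz
  have hA'fg : A'.FG := ⟨tA ∪ tB.image fun b : kb => (b : K), by rw [Finset.coe_union]⟩
  have hA'fr : IsFractionRing A' K := by
    haveI := hAfr
    refine IsFractionRing.of_field A' K fun z => ?_
    obtain ⟨a, b, -, rfl⟩ := IsFractionRing.div_surjective (A := A) z
    exact ⟨⟨a, hAA' a.2⟩, ⟨b, hAA' b.2⟩, rfl⟩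
  -- `X_{1,B′} = Nr_{K₁}(X″)`
  have hXA' : etaModel kb C B'.toSubring = nrIn (A'.toSubring.map (algebraMap K K₁)) := by
    refine le_antisymm ?_ ?_
    · have h1 : C ⊔ B'.toSubring.map (algebraMap kb K₁) ≤ nrIn (A'.toSubring.map (algebraMap K K₁)) := by
        refine sup_le ?_ ?_
        · rw [hC]
          exact nrIn_mono (fun _ ⟨a, ha, e⟩ => ⟨a, hAA' ha, e⟩)
        · rintro _ ⟨b, hb, rfl⟩
          exact le_nrIn _ ⟨(b : K), hB'A' b hb, rfl⟩
      have h2 := nrIn_mono h1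
      rwa [nrIn_nrIn] at h2
    · refine nrIn_mono ?_
      rw [hA'def, Algebra.adjoin_eq_ring_closure, RingHom.map_closure, Subring.closure_le]
      rintro _ ⟨z, hz, rfl⟩
      rcases hz with ⟨c, rfl⟩ | hz | hz
      · exact (le_sup_right : B'.toSubring.map (algebraMap kb K₁) ≤ _)
          ⟨algebraMap k kb c, B'.algebraMap_mem c, rfl⟩
      · exact (le_sup_left : C ≤ _) (hAC ⟨z, htAA hz, rfl⟩)
      · obtain ⟨b, hb, rfl⟩ := Finset.mem_image.mp (Finset.mem_coe.mp hz)
        exact (le_sup_right : B'.toSubring.map (algebraMap kb K₁) ≤ _) ⟨b, htBB hb, rfl⟩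
  obtain ⟨NX, hNXset, hNXfg, hNXfr, hNXn⟩ := exists_normalisation_in_extension A' hA'fg hA'fr L₁
  have hmemNX : ∀ z : L₁, z ∈ NX ↔ IsIntegral (A'.map (IsScalarTower.toAlgHom k K L₁)) z :=
    fun z => by rw [← SetLike.mem_coe, hNXset]; rfl
  have hmemX' : ∀ z : L₁, IsIntegral (etaModel kb C B'.toSubring) z ↔
      IsIntegral (A'.map (IsScalarTower.toAlgHom k K L₁)) z := fun z => by
    rw [isIntegral_map_iff A' z, ← isIntegral_subringMap_iff A' z, hXA', isIntegral_nrIn_iff,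
      ← isIntegral_subring_map_iff (A'.toSubring.map (algebraMap K K₁)) z, Subring.map_map,
      ← IsScalarTower.algebraMap_eq K K₁ L₁]
  let eX : NX ≃ₐ[k] integralClosure (etaModel kb C B'.toSubring) L₁ :=
    { toFun := fun z => ⟨z.1, (hmemX' z.1).mpr ((hmemNX z.1).mp z.2)⟩
      invFun := fun z => ⟨z.1, (hmemNX z.1).mpr ((hmemX' z.1).mp z.2)⟩
      left_inv := fun _ => rfl
      right_inv := fun _ => rfl
      map_mul' := fun _ _ => rfl
      map_add' := fun _ _ => rfl
      commutes' := fun c => Subtype.ext (show algebraMap k L₁ c = θ (algebraMap k l c) from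
        (hθk c).symm) }
  haveI : Algebra.FiniteType l (integralClosure (etaModel kb C B'.toSubring) L₁) := by
    have h1 : Algebra.FiniteType k NX := (Subalgebra.fg_iff_finiteType _).mp hNXfg
    have h2 : Algebra.FiniteType k (integralClosure (etaModel kb C B'.toSubring) L₁) := h1.equiv eX
    exact Algebra.FiniteType.of_restrictScalars_finiteType k l _
  ------------------------------------------------------------------
  -- descent of `l`-smoothness along the smooth-equivalence (Step 4: "`x₁` is `l`-smooth")
  ------------------------------------------------------------------
  have hpow : ∀ c : l, ∃ n : ℕ, c ^ q ^ n ∈ (algebraMap k l).range := fun c =>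
    IsPurelyInseparable.pow_mem k q c
  have hΛ : ∀ (D : Type u) [CommRing D]
      [Algebra (integralClosure (etaModel kb C B'.toSubring) L₁) D]
      [Algebra (integralClosure (etaModel kb C' B'.toSubring) m') D],
      (algebraMap (integralClosure (etaModel kb C B'.toSubring) L₁) D).comp
          (algebraMap B'.toSubring (integralClosure (etaModel kb C B'.toSubring) L₁)) =
        (algebraMap (integralClosure (etaModel kb C' B'.toSubring) m') D).comp
          (algebraMap B'.toSubring (integralClosure (etaModel kb C' B'.toSubring) m')) →
      Algebra.Smooth (integralClosure (etaModel kb C B'.toSubring) L₁) D →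
      Algebra.Smooth (integralClosure (etaModel kb C' B'.toSubring) m') D →
      (algebraMap (integralClosure (etaModel kb C B'.toSubring) L₁) D).comp
          (algebraMap l (integralClosure (etaModel kb C B'.toSubring) L₁)) =
        (algebraMap (integralClosure (etaModel kb C' B'.toSubring) m') D).comp
          (algebraMap l (integralClosure (etaModel kb C' B'.toSubring) m')) := by
    intro D _ _ _ hcomp hXD hYD
    rcases subsingleton_or_nontrivial D with hD | hD
    · exact RingHom.ext fun _ => Subsingleton.elim _ _
    haveI := hXD
    haveI : IsReduced D :=
      isReduced_of_smooth_of_isDomain (integralClosure (etaModel kb C B'.toSubring) L₁) D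
    haveI : ExpChar D q := expChar_of_injective_ringHom
      (f := (algebraMap (integralClosure (etaModel kb C B'.toSubring) L₁) D).comp
        (algebraMap k (integralClosure (etaModel kb C B'.toSubring) L₁)))
      (RingHom.injective _) q
    refine ringHom_eq_of_comp_eq_of_forall_pow_mem q (algebraMap k l) hpow ?_
    refine RingHom.ext fun c => ?_
    simp only [RingHom.comp_apply]
    -- both sides are the image of `c` through the common base `B′`
    have hXc : algebraMap l (integralClosure (etaModel kb C B'.toSubring) L₁) (algebraMap k l c) =
        algebraMap B'.toSubring (integralClosure (etaModel kb C B'.toSubring) L₁) (kToR c) := by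
      apply Subtype.ext
      rw [halgX', hθk]
      show algebraMap k L₁ c = algebraMap B'.toSubring L₁ (kToR c)
      rfl
    have hYc : algebraMap l (integralClosure (etaModel kb C' B'.toSubring) m') (algebraMap k l c) =
        algebraMap B'.toSubring (integralClosure (etaModel kb C' B'.toSubring) m') (kToR c) := by
      apply Subtype.ext
      rw [halgY', ← IsScalarTower.algebraMap_apply k l m']
      show algebraMap k m' c = algebraMap B'.toSubring m' (kToR c)
      rw [IsScalarTower.algebraMap_apply k kb m' c]
      rfl
    rw [hXc, hYc]
    exact congrArg (fun φ : B'.toSubring →+* D => φ (kToR c)) hcomp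
  have hx'sm : Algebra.IsSmoothAt l x' := AreSmoothEquivalent.isSmoothAt_left_of_field' h285 hΛ hsmY'
  ------------------------------------------------------------------
  -- packaging: `l₁ = θ(l) ⊆ L = K(L^Y) ⊆ L₁`, `X″ = Spec A′`, `N = Nr_{L₁}(X″)`
  ------------------------------------------------------------------
  -- (`l₁`, `e₁` are introduced opaquely: the unifier must not see `θa.fieldRange`)
  obtain ⟨l₁, hl₁⟩ : ∃ l₁ : IntermediateField k L₁, θa.fieldRange = l₁ := ⟨_, rfl⟩
  obtain ⟨e₁, he₁⟩ : ∃ e₁ : l ≃ₐ[k] l₁, ∀ c : l, ((e₁ c : l₁) : L₁) = θ c := by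
    refine ⟨(AlgEquiv.ofInjectiveField θa).trans (IntermediateField.equivOfEq hl₁), fun c => ?_⟩
    show (((IntermediateField.equivOfEq hl₁) (AlgEquiv.ofInjectiveField θa c) : l₁) : L₁) = θ c
    rw [IntermediateField.equivOfEq_apply]
    show ((AlgEquiv.ofInjectiveField θa c : θa.fieldRange) : L₁) = θ c
    rw [AlgEquiv.ofInjectiveField, AlgEquiv.ofInjective_apply]
    rfl
  have hmeml₁ : ∀ z : L₁, z ∈ l₁ ↔ ∃ c : l, θ c = z := fun z => by
    rw [← hl₁, AlgHom.mem_fieldRange]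
    rfl
  haveI hl₁fin : FiniteDimensional k l₁ := LinearEquiv.finiteDimensional e₁.toLinearEquiv
  haveI hl₁pi : IsPurelyInseparable k l₁ := AlgEquiv.isPurelyInseparable e₁
  let L : IntermediateField K L₁ := IntermediateField.adjoin K (Set.range (algebraMap LY L₁))
  have hl₁L : (l₁ : Set L₁) ⊆ (L : Set L₁) := by
    intro z hz
    obtain ⟨c, rfl⟩ := (hmeml₁ z).mp hz
    exact IntermediateField.subset_adjoin K _ ⟨lToLY c, rfl⟩
  haveI hLpi : IsPurelyInseparable K L := by
    rw [IntermediateField.isPurelyInseparable_adjoin_iff_pow_mem K L₁ q]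
    rintro _ ⟨w, rfl⟩
    obtain ⟨n, y, hy⟩ := IsPurelyInseparable.pow_mem kb q w
    refine ⟨n, (y : K), ?_⟩
    rw [← map_pow, ← hy, ← IsScalarTower.algebraMap_apply kb LY L₁]
    rfl
  have hadjK₁L : Algebra.adjoin K₁ (L : Set L₁) = ⊤ := by
    rw [eq_top_iff, ← hadjL₁']
    exact Algebra.adjoin_mono (IntermediateField.subset_adjoin K _)
  have hl₁NX : ∀ c : l₁, (c : L₁) ∈ NX := by
    intro c
    obtain ⟨c₀, hc₀⟩ := (hmeml₁ (c : L₁)).mp c.2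
    rw [← hc₀]
    exact (hmemNX _).mpr ((hmemX' _).mp (hθint c₀))
  have hNXO : NX.toSubring ≤ O₁'.toSubring := fun z hz => hX'O z ((hmemX' z).mpr ((hmemNX z).mp hz))
  let eA : integralClosure (etaModel kb C B'.toSubring) L₁ ≃+* NX :=
    { toFun := fun z => ⟨z.1, (hmemNX z.1).mpr ((hmemX' z.1).mp z.2)⟩
      invFun := fun z => ⟨z.1, (hmemX' z.1).mpr ((hmemNX z.1).mp z.2)⟩
      left_inv := fun _ => rfl
      right_inv := fun _ => rfl
      map_mul' := fun _ _ => rfl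
      map_add' := fun _ _ => rfl }
  have heA : ∀ r : l, ((eA (algebraMap l (integralClosure (etaModel kb C B'.toSubring) L₁) r) : NX) :
      L₁) = (((e₁ : l ≃+* l₁) r : l₁) : L₁) := fun r => by
    rw [show (((e₁ : l ≃+* l₁) r : l₁) : L₁) = ((e₁ r : l₁) : L₁) from rfl, he₁]
    rfl
  have hx'mem : ∀ z : integralClosure (etaModel kb C B'.toSubring) L₁,
      z ∈ x' ↔ (⟨((eA z : NX) : L₁), hNXO (eA z).2⟩ : O₁') ∈ maximalIdeal O₁' := fun z => by
    rw [hx'def, Ideal.mem_comap]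
    rfl
  exact descentConclusionWeak_of_data O A K₁ O₁ L₁ l₁ L hl₁L hadjK₁L A' hAA' hA'O hA'fg hA'fr
    O₁' hO₁' NX hl₁NX hNXO hNXset hNXfg hNXfr l (integralClosure (etaModel kb C B'.toSubring) L₁)
    (e₁ : l ≃+* l₁) eA heA x' hx'sm hx'mem

end stepFour

/-! ### Steps 3–4 assembled: the weak descent conclusion from the data of `Temkin2013_Steps34` -/

/-- **Steps 3–4 of the proof of Thm. 4.1.1, up to the last sentence of Step 4** ("replacing `l`
with a purely inseparable extension, we can also arrange that `x₁` is a simple `l`-smooth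
point"), PROVED from Lemma 2.8.4 (`Temkin2013_Lemma284_holds`), the openness of `S₁` in `Nr_m(S)`
(`Temkin2013_valuationRingOpen_holds`), Lemma 2.8.5 (`Temkin2013_Lemma285_normal_holds`), E.
Noether's finiteness of integral closure and descent of `l`-smoothness along smooth covers over
a field (`AreSmoothEquivalent.isSmoothAt_left_of_field'`) — all theorems of the tree: for the data
of `Temkin2013_Steps34_tower` (verbatim its binders), the WEAK descent conclusion
`Temkin2013DescentConclusionWeak` holds. Assembly: Step 3
(`exists_level_areSmoothEquivalent`) gives a level `Y₁ = Spec B₁`; Thm. 4.1.1 for `Y` — the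
hypothesis `Temkin2013DescentFor k k̄ k̄°` — is applied to the normal affine model `Nr_{k̄}(Y₁)`
and `(m, m°)`, producing a refinement `Y′ = Spec B′` of it, `m′ = L^Y m ⊇ L^Y ⊇ l` and the
`l`-smooth centre `y′`; Step 4 (`descentConclusionWeak_of_level`) at the level `B′`.
[cite: Temkin2013, proof of Thm. 4.1.1, Steps 3–4 (arXiv:0804.1554v3 pp. 48–49)] -/
theorem descentConclusionWeak_of_steps34Data :
    ∀ (k K : Type u) [Field k] [Field K] [Algebra k K], (⊤ : IntermediateField k K).FG →
    ∀ (O : ValuationSubring K), (∀ c : k, algebraMap k K c ∈ O) →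
    ∀ (kb : IntermediateField k K), (⊤ : IntermediateField k kb).FG →
      ringKrullDim (O.comap (algebraMap kb K)) ≤ 1 →
      Temkin2013DescentFor k kb (O.comap (algebraMap kb K)) →
    ∀ (B : Subalgebra k kb), B.toSubring ≤ (O.comap (algebraMap kb K)).toSubring → B.FG →
      IsFractionRing B kb →
    ∀ (A : Subalgebra k K), A.toSubring ≤ O.toSubring → A.FG → IsFractionRing A K →
      (∀ x : K, IsIntegral A x → x ∈ A) → (∀ b : B, algebraMap kb K b ∈ A) →
    ∀ (K₁ : Type u) [Field K₁] [Algebra K K₁], FiniteDimensional K K₁ →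
    ∀ (O₁ : ValuationSubring K₁), O₁.comap (algebraMap K K₁) = O →
    ∀ (m : Type u) [Field m] [Algebra kb m], FiniteDimensional kb m →
    ∀ (Om : ValuationSubring m), Om.comap (algebraMap kb m) = O.comap (algebraMap kb K) →
    ∀ (hXS : etaModel kb (nrIn (A.toSubring.map (algebraMap K K₁)))
        (O.comap (algebraMap kb K)).toSubring ≤ O₁.toSubring)
      (hOm : ∀ c : (O.comap (algebraMap kb K)).toSubring, algebraMap kb m c ∈ Om),
      AreSmoothEquivalent
        (etaModelBaseMap (nrIn (A.toSubring.map (algebraMap K K₁)))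
          (O.comap (algebraMap kb K)).toSubring)
        (((algebraMap kb m).comp (O.comap (algebraMap kb K)).toSubring.subtype).codRestrict Om hOm)
        ((IsLocalRing.maximalIdeal O₁).comap (Subring.inclusion hXS))
        (IsLocalRing.maximalIdeal Om) →
      Temkin2013DescentConclusionWeak k K O A K₁ O₁ := by
  intro k K _ _ _ _hfg O hk kb _hkbfg hdim hDY B hBO hBfg hBfr A hAO hAfg hAfr _hAn hBA K₁ _ _ hfin₁
    O₁ hO₁ m _ _ hfinm Om hOm hXS hOm' hASE
  haveI := hfin₁
  haveI := hfinm
  -- Step 3: a level `Y₁ = Spec B₁` below which the centres stay smooth-equivalent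
  obtain ⟨B₁, hBB₁, hB₁fg, hB₁O, hlevel⟩ := exists_level_areSmoothEquivalent O kb hdim B hBO hBfg
    hBfr A hAfg hAfr hBA K₁ O₁ m Om hOm hXS hOm' hASE
  have hB₁fr : IsFractionRing B₁ kb := by
    haveI := hBfr
    refine IsFractionRing.of_field B₁ kb fun z => ?_
    obtain ⟨a, b, -, rfl⟩ := IsFractionRing.div_surjective (A := B) z
    exact ⟨⟨a, hBB₁ a.2⟩, ⟨b, hBB₁ b.2⟩, rfl⟩
  -- Thm. 4.1.1 for `Y`, applied to the normal affine model `Nr_{k̄}(Y₁)` and `(m, m°)`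
  obtain ⟨Bn, hB₁Bn, hBnO, hBnfg, hBnfr, hBnn, -⟩ :=
    exists_normal_affineModel_ge' (O.comap (algebraMap kb K)) B₁ hB₁O hB₁fg hB₁fr
  obtain ⟨m', iF, iAm, iAkb, iAk, iT1, iT2, hfin', -, l, hlfin, hlpi, LY, hlLY, hLYpi, hadjY, B',
    hBnB', hB'O, hB'fg, hB'fr, Om', hOm'c, NY, hNY, hNYint, hNYfg, -, hsmY, -, -⟩ :=
    hDY Bn hBnO hBnfg hBnfr hBnn m inferInstance Om hOm
  letI := iF
  letI := iAm
  letI := iAkb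
  letI := iAk
  haveI := iT1
  haveI := iT2
  haveI := hfin'
  haveI := hlfin
  haveI := hlpi
  haveI : IsPurelyInseparable kb LY := hLYpi
  -- the level `Y′ = Spec B′`
  have hB₁B' : B₁ ≤ B' := hB₁Bn.trans hBnB'
  obtain ⟨hX, hY, hSE⟩ := hlevel B' hB₁B' hB'fg hB'O
  -- Step 4
  exact descentConclusionWeak_of_level O hk kb B A hAO hAfg hAfr K₁ O₁ hO₁ m Om _ rfl _ rfl B'
    (hBB₁.trans hB₁B') hB'fg hB'O hB'fr hX hY hSE m' l LY hlLY hadjY Om' hOm'c NY hNY hNYint hsmY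


end Literature.AlgebraicGeometry.Resolution
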